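import Mathlib
import HarnessLib
import HarnessLib.Audit
import Summits.Langlands.Statement
import Literature.FieldTheory.AlgClosed.PadicAlgClEquivComplex
import Literature.NumberTheory.PAdicHodge.FontaineDpst
import Literature.NumberTheory.Automorphic.LocalLanglandsGLProofs
import Literature.NumberTheory.Automorphic.LocalConstantsProofs
import Summits.Langlands.Langlands.Theorems.EisensteinDegreeShiftSectorComplementStubAvatarConjugacy
import Literature.NumberTheory.GaloisRepresentations.WeilDeligneRepFrobSemisimpleProofs
import Literature.NumberTheory.Automorphic.IwahoriGL
import Summits.Langlands.Langlands.Theorems.GenericWDUnique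
import HarnessLib.Audit.Status.Attr

/-!
Route: RootDecomp1

# Route RootDecomp1 — Root decomposition of GL(n) reciprocity below the prime-switch node — avatars
split by semisimplicity, local-global compatibility split into Weil-group matching and monodromy

ROOT DECOMPOSITION CELL decomp-langlands (D-0178/D-0179, residual mode) — writer file, generation 0,
rung 0 (nothing here
proves `Langlands`). Target = the ROOT `_root_.Langlands` exactly as typed. LEVEL 1 = the
kernel-certified exact AND-node N0
of record (route PrimeSwitchSplit rev 4: `Langlands ↔ B_w ∧ W⁺ ∧ P ∧ L∤R ∧ CRD`, 0 costume; census
COSTUME-CENSUS-v1 (pub/decomp-langlands/census/COSTUME-CENSUS-v1.md sha256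
4dd86a1c95c3dbcae1ba46b059518d916addeabf0df4247f8f7bb875cbf7af12; .json sha256
6ef7e575583e59f113ec3a2df34171db11ca53196160bbf000444c216d229c7d) rows R01/K1), its
items restated VERBATIM so the ledger shares them (17414 B_w, 17415 W⁺, 17534 P, 18084 L∤R, 17930
CRD; U 17844 is PROVED and
is consumed as the theorem `EisensteinDegreeShiftSectorComplement.stub_avatarConjugacy`). LEVEL 2 =
the two critic-CLEARED
genuine splits (CLEARED decomp-langlands-crit-1-g0 0 2026-08-30T01:15:58Z
(pub/decomp-langlands/STATUS.md; CRITIC-LEDGER.md row 01:15:58Z)): W⁺ ⟸ SemisimpleAvatar ∧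
CuspidalAvatarIrreducible (existence of a semisimple Satake avatar /
irreducibility of semisimple avatars of cuspidal π) and L∤R ⟸ G ∧ R ∧ S ∧ N along the two halves of
a Weil–Deligne
representation (G Satake places for every datum, R rigidity of pinned data, S trace matching on the
Weil group at the
exceptional places for ONE datum, N the monodromy upgrade). W⁺ and L∤R stay as internal AND-nodes
proved inside `closes`.
It suffices to show X = B_w ∧ SemisimpleAvatar ∧ CuspidalAvatarIrreducible ∧ P ∧ G ∧ R ∧ S ∧ N ∧
CRD.
Lean: `WeakGeometricAutomorphy ∧ SemisimpleAvatar ∧ CuspidalAvatarIrreducible ∧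
PadicMemberCompatibility ∧ SatakePlacesAllData ∧ RecRigidity ∧ SemisimpleMatchingOneDatum ∧
MonodromyUpgrade ∧ CanonicalReciprocityData`
PIECE TAGS (critic verdicts cited from CLEARED decomp-langlands-crit-1-g0 0 2026-08-30T01:15:58Z
(pub/decomp-langlands/STATUS.md; CRITIC-LEDGER.md row 01:15:58Z); census C/W/U of N0 = 0/6/0): B_w
17414 WEAKER (cert
`weakGeometricAutomorphy_of_langlands`), leaf IDEA-NEEDED +
BARRIER(Literature.Barriers.Langlands.NonRegularWeightBarrier ·
ResiduallyReducibleBarrier · TaylorWilesNumericalCoincidence · ShimuraVarietyRealizationBarrier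
bound the lifting class, not the
statement) — the declared residual of this generation (lens-3 node ResidualSplit B_w ⟸ Serre_w ∧
Lift_w awaits the critic) ·
SemisimpleAvatar WEAKER, leaf IDEA-NEEDED + BARRIER(ShimuraVarietyRealizationBarrier ·
NonRegularWeightBarrier on the irregular /
general-K sector; RA ∧ TR/CM sector closed-mod-print = fact lang.S27
`exists_galoisRep_of_regularAlgebraic`) ·
CuspidalAvatarIrreducible WEAKER (necessity via `SoloBlind.isIrreducible_of_eventually`), leaf
IDEA-NEEDED (open n ≥ 4 where
existence is known), «no catalogued barrier» · P 17534 WEAKER, leaf IDEA-NEEDED (+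
definition-blocked D2 on the ramified
WD∘D_pst sector), its cleared conjunct split DeRhamMember ∧ CrossPrimeClass deferred to tenure · G
WEAKER, leaf ATTACKABLE NOW
(in tree n ≥ 2: `ReciprocityUpToIrreducibility.localGlobalCompatibleAt_of_satakeFrobCompatibleAt`) ·
R WEAKER, leaf ATTACKABLE
closed-mod-print (Henniart 1993/2002 via landed
`ReciprocityUpToIrreducibilityR.stub_genericRigidity_of_facts`) · S WEAKER, OPEN,
leaf IDEA-NEEDED, «no catalogued barrier» (RA/CM-TR sector closed-mod-print
`Varma2024.theorem12_trace_eq_and_precI`) · N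
WEAKER, OPEN, leaf BARRIER(Literature.Barriers.Langlands.MonodromyNotClosedUnderPadicLimits,
`not_ladicLimitsPreserveMonodromy`)
+ IDEA-NEEDED · L∤R 18084 WEAKER internal node · W⁺ 17415 WEAKER internal node · CRD 17930 WEAKER,
leaf ATTACKABLE
closed-mod-print (reduction landed `stub_nonempty_of_inputs`). No EQUIV layer is used anywhere in
this file.

## Assembly
`closes (hB : WeakGeometricAutomorphy) (hSS : SemisimpleAvatar) (hIrr : CuspidalAvatarIrreducible)
(hP : PadicMemberCompatibility)
(hG : SatakePlacesAllData) (hRig : RecRigidity) (hS : SemisimpleMatchingOneDatum) (hN :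
MonodromyUpgrade) (hR : CanonicalReciprocityData)
: _root_.Langlands` is PROVED in glue.lean (one theorem, 0 sorry, ≈ 110 lines, axioms propext /
Classical.choice / Quot.sound;
gate self-check `#h21_check_closes` ok, conclusion `Langlands`, cone = all items): it proves the
item `Assembly` (the curried
form) and applies it; inside, (1) `have hW : SatakeAvatarExistence` from hSS, hIrr; (2) `have hA :
CompatibilityAwayFromLR` — fix
Rec and v ∤ ℓ; Satake place: G at Rec; exceptional place: S yields (π_v, W, Wℂ, S) for Rec₀ with
equal traces, N at Rec₀ gives
`Wℂ.HasFrobSemisimpleClass (rec_Rec₀,v π_v)`, which assembles `LocalGlobalCompatibleAt Rec₀ ι π ρ v`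
(the v ∣ ℓ clause is
vacuous) and R transports it to Rec (Rec enters only through the class of π_v); (3) N0's glue
verbatim: `⟨hR F, …⟩`; every finite
place misses 2 or 3; for v ∣ ℓ take ℓ′ ∈ {2,3} with ℓ′ ∤ v, an ℓ′-adic avatar ρ′ (hW), its
compatibility at v (hA) and move it to
ρ by P(ii); P(i) gives pinned geometricity; (A) = hW + this + U (the proved theorem
`stub_avatarConjugacy`), (B) = B_w + this.

Rationale: WHY THIS LINE. The census of record (COSTUME-CENSUS-v1
(pub/decomp-langlands/census/COSTUME-CENSUS-v1.md sha256
4dd86a1c95c3dbcae1ba46b059518d916addeabf0df4247f8f7bb875cbf7af12; .json sha256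
6ef7e575583e59f113ec3a2df34171db11ca53196160bbf000444c216d229c7d); 130 rows) reads every existing
root split of `Langlands` as REDUCED and every live sector route
as hanging on a COSTUME junction `X → Langlands` (kernel iffs, row K1); the only 0-costume root
nodes are N0 PrimeSwitchSplit
and N0′ CompatibleFamilySplit, whose pieces are the Rec-free open cores — novelty at level 1 is nil
(critic, 01:15:58Z), so
the deliverable is BELOW level 1. This file lowers two cores by splits the tree already carries as
REGISTERED SKELETONS but
never as items: Cruxes/SectorComplement/Lines/birth_SatakeAvatarExistence.lean
(`SatakeAvatarExistence_of`) and
Cruxes/CompatibilityAwayFromLR/Lines/birth.lean (`CompatibilityAwayFromLR_of`), both kernel-checked.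
Sources: avatars —
HarrisLanTaylorThorneRMS2016, Scholze2015, BuzzardGeeLMS2014 (Conj. 3.2.1/3.2.2), irreducibility
PatrikisTaylor2014,
BockleHui2025, Ramakrishnan; local–global — TaylorGaloisRepresentations2004 Conj. 7,
HarrisTaylorAMS2001, HenniartBSMF2002
(rigidity of rec on generic classes), VarmaFMS2024 Thm 1–2 (trace identity and ≺ for regular π over
CM/TR), TaylorYoshida2007
and Caraiani2012 (monodromy in the polarizable case). Imported area: local representation theory of
GL_n (Bernstein–Zelevinsky
genericity, the algebra of Weil–Deligne modules); no analytic input. What it does that prior routes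
do not: the monodromy
programme of routes ParahoricFibre / EisensteinMonodromy (target GenericMonodromy 10863, junction
MonodromyToLanglands = COSTUME,
census R14/R15) gets a NON-COSTUME parent — N is the all-sector statement of which GenericMonodromy
is the CM-regular sector,
and G ∧ R ∧ S ∧ N → L∤R → (with N0) Langlands is proved by the kernel in `closes`; likewise the
irreducibility programme
(IrreducibilityBySelfDuality, ExteriorSquareAscent, FrobeniusMoment; census P6 residue (ii)) gets
CuspidalAvatarIrreducible as
its Rec-free root-level parent instead of the junction `E ∧ I ↔ Langlands`.

RANKED CRUXES. #2 WeakGeometricAutomorphy (crux) — [N0 core B_w = stmt-Langlands-17414 verbatim;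
WEAKER; leaf IDEA-NEEDED/BARRIER as in PIECE TAGS; the declared residual of generation 0]
Fontaine–Mazur–Langlands, a.e. form: every irreducible ρ : Γ_K → GL_n(ℚ̄_ℓ), unramified a.e. and de
Rham above ℓ for Fontaine's pinned datum, is Satake–Frobenius compatible a.e. with an L-algebraic
cuspidal π of GL_n(𝔸_K). [difficulty: open-problem] (why it might fail: Automorphy lifting exists
only for regular, residually adequate ρ over TR/CM fields and gives POTENTIAL automorphy (BLGGT
4.2.1, ten-author 6.1.1); irregular weights / general K have no engine even for n = 2.)
[FontaineMazurGeometric1995, BuzzardGeeLMS2014, ACCGHLNSTT2023, BarnetlambEtAl2014, Kisin2009]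
#3 SemisimpleAvatar (crux) — [NEW root-level piece, the existence half of W⁺; verbatim the
registered stub
`Summit.Langlands.Langlands.Cruxes.SectorComplement.BirthSatakeAvatarExistence.stub_semisimpleAvatar`;
WEAKER than W⁺ (drops irreducibility) and than Langlands; leaf IDEA-NEEDED,
BARRIER(Literature.Barriers.Langlands.ShimuraVarietyRealizationBarrier, NonRegularWeightBarrier) on
the irregular / general-K sector, RA ∧ TR/CM sector closed-mod-print by the fact
`Literature.NumberTheory.Automorphic.exists_galoisRep_of_regularAlgebraic` (lang.S27; C- vs
L-normalisation transport `arithFrobPolyOfSatake ι q n α` ↔ `… 1 α` to be supplied); critic: CLEARED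
decomp-langlands-crit-1-g0 0 2026-08-30T01:15:58Z (pub/decomp-langlands/STATUS.md; CRITIC-LEDGER.md
row 01:15:58Z)] for every number field K, n ≥ 1, every L-algebraic cuspidal π of GL_n(𝔸_K) and every
(ℓ, ι) there is a SEMISIMPLE framed ρ : Γ_K → GL_n(ℚ̄_ℓ) Satake–Frobenius compatible with (π, ι) at
almost all places. [difficulty: open-problem] (why it might fail: No construction of any Galois
representation for irregular L-algebraic π (Maass-type infinity components) or for K neither totally
real nor CM — no Shimura variety or shtuka realises them.) [HarrisLanTaylorThorneRMS2016,
Scholze2015, BuzzardGeeLMS2014, Clozel1990AnnArbor]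
#4 MonodromyUpgrade (crux) — [NEW root-level piece N = the monodromy half of L∤R; verbatim the
registered stub `…Cruxes.CompatibilityAwayFromLR.Birth.stub_monodromyUpgrade`; WEAKER than L∤R
(implied via Deligne's independence of (t, Φ) `IsWeilDeligneOfLadic.isEquivalent` + uniqueness of
local components; does not give the trace identity S) and than Langlands; OPEN; leaf
BARRIER(Literature.Barriers.Langlands.MonodromyNotClosedUnderPadicLimits,
`not_ladicLimitsPreserveMonodromy`: N is lost under ℓ-adic limits) + IDEA-NEEDED; known: polarizable
regular case (Taylor–Yoshida, Caraiani), Varma 2024 only Wℂ ≺ S; non-costume parent of the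
CM-regular target `EisensteinMonodromy.GenericMonodromy` (10863); critic: CLEARED crit-1-g0
2026-08-30T01:15:58Z] for EVERY pinned datum Rec, every L-algebraic cuspidal π, every irreducible
pinned-geometric Satake-compatible ρ, every v ∤ ℓ, local component π_v, Weil–Deligne module W of
ρ|_v with transport Wℂ along ι and Frobenius-semisimple S ∈ rec_Rec,v(π_v): tr Wℂ = tr S on W_K_v ⟹
Wℂ ≃ S up to F-semisimplification (`HasFrobSemisimpleClass`), i.e. ρ has the generic monodromy at v.
[deps: SemisimpleMatchingOneDatum] [difficulty: open-problem] (why it might fail: Weight–monodromy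
for automorphic Galois representations is known only in the polarizable regular case; for
non-polarizable regular π over CM only Wℂ ≺ rec is known (Varma 2024), and every known construction
there is an ℓ-adic limit, which destroys N.) [TaylorYoshida2007, Caraiani2012, VarmaFMS2024,
arXiv:1407.2135]
#5 SemisimpleMatchingOneDatum (crux) — [NEW root-level piece S = the Weil-group half of L∤R;
verbatim the registered stub
`…Cruxes.CompatibilityAwayFromLR.Birth.stub_semisimpleMatchingOneDatum`; WEAKER than L∤R (Wℂ^F-ss ≅
S preserves traces; S does not return the monodromy) and than Langlands
(`compatibilityAwayFromLR_of_langlands`); OPEN; leaf IDEA-NEEDED, «no catalogued barrier» (the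
avatar's construction sector inherits ShimuraVarietyRealization / NonRegularWeight); RA ∧ CM/TR
sector closed-mod-print by the fact `Varma2024.theorem12_trace_eq_and_precI`; critic: CLEARED
crit-1-g0 2026-08-30T01:15:58Z] for every K carrying reciprocity data there is ONE pinned datum Rec₀
such that for every L-algebraic cuspidal π of GL_n(𝔸_K), every (ℓ, ι), every irreducible
pinned-geometric ρ Satake-compatible with (π, ι) a.e. and every exceptional place v ∤ ℓ there exist
the local component π_v, a Weil–Deligne module W of ρ|_W_v (Grothendieck), its transport Wℂ along ι
and a Frobenius-semisimple S ∈ rec_Rec₀,v(π_v) with tr Wℂ = tr S on W_K_v. [deps: SemisimpleAvatar]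
[difficulty: open-problem] (why it might fail: Known only for regular algebraic π over TR/CM K
(Varma 2024; polarizable: Harris–Taylor, Taylor–Yoshida); for irregular π or general K no avatar
with controlled ramified traces exists — it inherits W⁺'s construction problem at the bad places.)
[TaylorGaloisRepresentations2004, VarmaFMS2024, HarrisTaylorAMS2001, Caraiani2012]
#6 PadicMemberCompatibility (crux) — [N0 core P = stmt-Langlands-17534 verbatim; WEAKER (cert
`padicMemberCompatibility_of_langlands`); leaf IDEA-NEEDED (+ definition-blocked D2: WD ∘ D_pst
pinned only on unramified ρ); its conjunct split DeRhamMember ∧ CrossPrimeClass is critic-CLEARED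
and deferred to a tenure `--split`; barrier on the torsion-limit sector:
Literature.Barriers.Langlands.MonodromyNotClosedUnderPadicLimits] for an irreducible ℓ-adic avatar ρ
of an L-algebraic cuspidal π and v ∣ ℓ: (i) ρ|_v is de Rham for Fontaine's pinned datum; (ii) for
every datum Rec, local–global compatibility at v transfers to ρ from any irreducible ℓ′-adic avatar
ρ′ of π with ℓ′ ∤ v (Fontaine's C_WD for the system). [deps: SemisimpleAvatar,
CuspidalAvatarIrreducible] [difficulty: open-problem] (why it might fail: ℓ = p compatibility for
torsion-limit representations is known only up to semisimplification (AHTW 2026 Thm 1.2.1, regular π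
over CM); the monodromy at p, irregular π and general K are open.) [FontaineAsterisque223VIII,
Caraiani2014, AHTW2026, arXiv:math/0612077]
#7 CuspidalAvatarIrreducible (crux) — [NEW root-level piece, the irreducibility half of W⁺; verbatim
the registered stub `…SectorComplement.BirthSatakeAvatarExistence.stub_cuspidalAvatarIrreducible`;
WEAKER than Langlands (necessity: a semisimple Satake-compatible ρ is conjugate to the irreducible
avatar by Chebotarev + Brauer–Nesbitt, cf. `SoloBlind.isIrreducible_of_eventually`); leaf
IDEA-NEEDED, «no catalogued barrier»; known: n ≤ 3 (Ribet, Blasius–Rogawski), polarizable regular n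
≤ 5 / density-one ℓ (Calegari–Gee, Patrikis–Taylor, Böckle–Hui 2025); Rec-free root-level parent of
the irreducibility sector routes (IrreducibilityBySelfDuality, ExteriorSquareAscent,
FrobeniusMoment); critic: CLEARED decomp-langlands-crit-1-g0 0 2026-08-30T01:15:58Z
(pub/decomp-langlands/STATUS.md; CRITIC-LEDGER.md row 01:15:58Z)] every SEMISIMPLE framed ρ : Γ_K →
GL_n(ℚ̄_ℓ) that is Satake–Frobenius compatible a.e. with an L-algebraic CUSPIDAL (π, ι) is
irreducible (Ramakrishnan's cuspidality ⇒ irreducibility conjecture, Satake-level form). [deps: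
SemisimpleAvatar] [difficulty: open-problem] (why it might fail: Open for n ≥ 4 in general even over
ℚ with regular weight (only density-one sets of ℓ, Patrikis–Taylor); for irregular π there is not
even a candidate argument, and potential automorphy of the summands is the missing input.)
[Ramakrishnan2008Irreducibility, PatrikisTaylor2014, CalegariGee2013, BockleHui2025]
#9 SatakePlacesAllData (support) — [piece G of the L∤R split; verbatim the registered stub
`…CompatibilityAwayFromLR.Birth.stub_goodPlaces`; WEAKER (a theorem); leaf ATTACKABLE NOW — n ≥ 2:
landed
`Summit.Langlands.Langlands.Theorems.ReciprocityUpToIrreducibility.stub_rankN_localGlobalCompatibleAt_of_satakeFrobCompatibleAt`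
/ `localGlobalCompatibleAt_away_of_isUnramifiedAt` (only the v ∤ ℓ branch is needed), n = 1:
`rankOne_localGlobalCompatibleAt_of_satakeFrobCompatibleAt`; critic: CLEARED
decomp-langlands-crit-1-g0 0 2026-08-30T01:15:58Z (pub/decomp-langlands/STATUS.md; CRITIC-LEDGER.md
row 01:15:58Z)] at a Satake-compatible place v ∤ ℓ the summit's LocalGlobalCompatibleAt Rec ι π ρ v
holds for EVERY pinned datum Rec (unramified local Langlands = the Satake parameter; Buzzard–Gee
3.2.1 is Taylor's clause there). [difficulty: provable-now] [BuzzardGeeLMS2014, JacquetShalika1981,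
TateCorvallis1979]
#9 RecRigidity (support) — [piece R of the L∤R split; verbatim the registered stub
`…CompatibilityAwayFromLR.Birth.stub_recRigidity`; WEAKER (L∤R forces it: landed
`Theorems/CompatibilityAwayFromLR/Negative/RigidOfCompatibilityAwayFromLR.lean`,
`recGL_eq_of_compatibilityAwayFromLR`); leaf ATTACKABLE closed-mod-print: conclusion of the landed
glue `ReciprocityUpToIrreducibilityR.stub_recRigidityLAlg_of_genericRigidity ∘
stub_genericRigidity_of_facts` from five local facts (localLanglands_gl, generic preimages, Henniart
2002 Thm 1.7(a) / 1.6(b), invariant measures); critic: CLEARED decomp-langlands-crit-1-g0 0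
2026-08-30T01:15:58Z (pub/decomp-langlands/STATUS.md; CRITIC-LEDGER.md row 01:15:58Z)] any two
pinned reciprocity data give the same class rec_v(π_v) to every local component of every L-algebraic
cuspidal π (Henniart's uniqueness of rec_v on generic classes; local components of cusp forms are
generic by Shalika). [difficulty: provable-now] [HenniartBSMF2002, HarrisTaylorAMS2001, Shalika1974]
#9 CanonicalReciprocityData (support) — [N0 support CRD = stmt-Langlands-17930 verbatim, the
summit's non-vacuity conjunct; WEAKER; leaf ATTACKABLE closed-mod-print (reduction landed
`ReciprocityUpToIrreducibilityR.stub_nonempty_of_inputs`; two named facts away); registered skeleton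
birth_CanonicalReciprocityData.lean] for every number field F, Nonempty (ReciprocityData F)
(Harris–Taylor Thm A / Henniart with the canonical Artin and ε pins). [difficulty: provable-now]
[HarrisTaylorAMS2001, HenniartInventiones2000, Deligne1973Constantes]
#9 SatakeAvatarExistence (support) — [INTERNAL AND-NODE W⁺ = stmt-Langlands-17415 verbatim (N0 crux
r3), proved INSIDE `closes` from SemisimpleAvatar ∧ CuspidalAvatarIrreducible (`have hW`, the
registered glue `SatakeAvatarExistence_of` re-proved over this route's decls); kept as an item so
the node of record stays shared with PrimeSwitchSplit and a direct proof remains claimable; WEAKER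
(cert `satakeAvatarExistence_of_langlands`)] every L-algebraic cuspidal π of GL_n(𝔸_K), n ≥ 1, has
at every (ℓ, ι) an IRREDUCIBLE ℓ-adic ρ Satake–Frobenius compatible with (π, ι) a.e. [difficulty:
open-problem] [BuzzardGeeLMS2014, HarrisLanTaylorThorneRMS2016, Scholze2015]
#9 CompatibilityAwayFromLR (support) — [INTERNAL AND-NODE L∤R = stmt-Langlands-18084 verbatim (N0
crux r5), proved INSIDE `closes` from G ∧ R ∧ S ∧ N (`have hA`, the registered glue
`CompatibilityAwayFromLR_of` re-proved over this route's decls: at a Satake place G; at an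
exceptional place S gives (π_v, W, Wℂ, S) for Rec₀ with equal traces, N upgrades to
`HasFrobSemisimpleClass`, R transports Rec₀ ↦ Rec); kept as an item so the node of record stays
shared with PrimeSwitchSplit; WEAKER (cert `compatibilityAwayFromLR_of_langlands`)] Taylor 2004
Conj. 7 at every v ∤ ℓ, for EVERY pinned reciprocity datum Rec, for irreducible pinned-geometric
Satake-compatible pairs (π L-algebraic cuspidal, ρ). [difficulty: open-problem]
[TaylorGaloisRepresentations2004, HarrisTaylorAMS2001, HenniartInventiones2000, VarmaFMS2024]

TWO-LAYER PLAN. Critic-CLEARED and deferred (tenure `ledger route edit --split`): P ⟸ DeRhamMember →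
CrossPrimeClass (registered skeleton
Cruxes/SectorComplement/Lines/birth_PadicMemberCompatibility.lean; definitional conjunct split, both
open, DeRhamMember's
RA/CM sector closed-mod-print by `AHTW2026.deRham_hodgeTateRegular`). Pending the critic: B_w ⟸
ResidualAutomorphy (Serre_w) →
AutomorphyLifting (Lift_w) (lens-3 node ResidualSplit 2026-08-30T01:20:59Z, one EQUIV through the
mod-ℓ dictionary, seam uses
W⁺) — on CLEARED it becomes `--split WeakGeometricAutomorphy --into ResidualAutomorphy
AutomorphyLifting` here or a lens-born
sibling route. REJECTED as a node (critic OBJECTION 01:15:58Z): the rank axis B_w ⟸ RankOne ∧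
HigherRank (HigherRank ≡ B_w mod a
print theorem) and any sector cut whose complementary sector is known. Next candidate split of N:
Dominance (Wℂ ≺ S, Varma-type,
all sectors) → GenericOfDominated (local algebra: ≺ + equal traces + generic target ⇒ ≅), cf.
skeleton Cruxes/GenericMonodromy/Lines/birth.lean.

KILL CRITERIA. A refutation of S, N, SemisimpleAvatar or CuspidalAvatarIrreducible AS TYPED (e.g. a
vacuous ∃-clause because
`HasLocalComponentAt` / `IsWeilDeligneOfLadic` is unsatisfiable in the tree for some legal datum)
breaks the corresponding
internal node: repair by re-typing along the registered skeletons' `_false_without_` lemmas, or fall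
back to N0 at that node
(re-instate 17415 / 18084 as the binder). A refutation of B_w, W⁺ or P kills N0 itself and with it
every root split of record.
If route PrimeSwitchSplit's items close, this file closes with them (shared items). The route is
superseded if a lens files a
root file whose leaves are strictly lower on BOTH the W⁺ and the L∤R axes.

NOT DECOMPOSED YET. B_w and P stay monolithic at this generation (B_w: no cleared node yet; P:
cleared split deferred to keep the open crux count at
six). The regime axis (regular ∧ CM/TR sector facts lang.S27, Varma2024, AHTW2026 vs the
NonRegularWeight /
ShimuraVarietyRealization complement) is deliberately NOT filed as a split: a bare sector complement
whose other side is known is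
a costume, and one whose other side is open is a declared residual, not a weaker piece.

CHEAPEST FALSIFIER. Instantiate S, N, SemisimpleAvatar and CuspidalAvatarIrreducible at n = 1
(characters: W = (χ_ℓ|W_v, N = 0), rec_v = class
field theory; a 1-dimensional semisimple ρ is irreducible): all four must reduce to provable
statements of the RankOne* files;
and run the tree's vacuity probes (`#h21_crux_probe`) on the four new items — an ∃-clause over
`SmoothIrrep` / `WeilDeligneRep`
that is unsatisfiable for definitional reasons would show as `crux.hyps-vacuous` / `crux.rigid`
(gate grounding batteries on
the self-check: no flags on any item).

NUMBERS. Census data of record: COSTUME-CENSUS-v1 (pub/decomp-langlands/census/COSTUME-CENSUS-v1.md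
sha256 4dd86a1c95c3dbcae1ba46b059518d916addeabf0df4247f8f7bb875cbf7af12; .json sha256
6ef7e575583e59f113ec3a2df34171db11ca53196160bbf000444c216d229c7d) — 130 rows, 76 route rows over 102
Theses files (30 OPEN / 8 DRAFT / 39 DORMANT / 23 CLOSED /
2 DONE); 0-costume root nodes: 2 (N0, N0′); this file: 12 items (6 cruxes, 5 supports, 1 assembly),
9 binders in `closes`
(6 open cruxes + 3 provable-now supports), 2 internal nodes, 0 EQUIV layers; leaves attackable now:
G, R, CRD (3).

DEFINITION REQUESTS. None new. P(ii)'s ramified sector still waits for definition item D2 (WD ∘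
D_pst on ramified ρ), as recorded on stmt-Langlands-17534.

Novelty: Searches (2026-08-30): tree — `rg` over Summits/Langlands/Langlands/Theses (the census's 102 route
files), Cruxes/CompatibilityAwayFromLR/Lines/birth.lean, Cruxes/SectorComplement/Lines/birth_*.lean,
Cruxes/GenericMonodromy/Lines/birth.lean, `ledger negatives --problem Langlands` (4 entries, none on
avatars or local–global compatibility); census COSTUME-CENSUS-v1
(pub/decomp-langlands/census/COSTUME-CENSUS-v1.md sha256
4dd86a1c95c3dbcae1ba46b059518d916addeabf0df4247f8f7bb875cbf7af12; .json sha256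
6ef7e575583e59f113ec3a2df34171db11ca53196160bbf000444c216d229c7d) rows R01, R02, R14–R16, P6, K1;
literature as recorded on N0's items (lit search "local-global compatibility l=p": arXiv:1202.4683,
1105.2240, 2407.00288; galaxy "local-global compatibility" --star all: 28 rows) — this writer seat
ran no new literature query (bookkeeping role; the lens and critic lines carry theirs).
Nearest prior art found: in tree, route-Langlands-PrimeSwitchSplit (N0, identical level 1) with its
registered skeletons `SatakeAvatarExistence_of` / `CompatibilityAwayFromLR_of` (the level-2 splits
as stubs, never items); routes ParahoricFibre / EisensteinMonodromy (the CM-regular sector of N as a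
target behind a costume junction); IrreducibilityBySelfDuality (`Langlands ↔ E ∧ I`, irreducibility
behind a junction). In print: Taylor 2004 Conj. 7; Taylor–Yoshida 2007 Thm 1.2; Caraiani 2012 Thm
1.1; Varma 2024 Thm 2 (≺ only); Ramakrishnan's cuspidality–irreducibility conjecture.
Delta: the first root-reachin  [refs: 1202.4683]

Barriers (technique_class: decomposition, local-global-compatibility, weil-deligne): - technique_class: decomposition, local-global-compatibility, weil-deligne
- Literature.Barriers.Langlands.MonodromyNotClosedUnderPadicLimits: threatens N (and P(ii)) head-on
for any proof that builds ρ as an ℓ-adic limit of automorphic representations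
(`not_ladicLimitsPreserveMonodromy`); it does not evade it; the bet is that N is attacked through
geometry (nearby cycles / weight spectral sequence: Taylor–Yoshida, Caraiani) or through the
dominance + genericity algebra (Varma ≺ plus an independent lower bound on rk N), not through
limits.
- Literature.Barriers.Langlands.NonRegularWeightBarrier: threatens SemisimpleAvatar, B_w and the
irregular sector of S (no avatar construction off cohomological weights); G, R, N,
CuspidalAvatarIrreducible are weight-blind as statements. Not evaded; routed to the SemisimpleAvatar
/ B_w nodes.
- Literature.Barriers.Langlands.ShimuraVarietyRealizationBarrier: threatens SemisimpleAvatar and S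
for K neither TR nor CM; the glue is field-blind. Not evaded; the bet is N0's.
- Literature.Barriers.Langlands.TaylorWilesNumericalCoincidence: threatens B_w only (automorphy
lifting at positive defect); no piece of the W⁺ or L∤R splits runs patching.
- Literature.Barriers.Langlands.ResiduallyReducibleBarrier: threatens B_w only; untouched by this
generation's splits.
- Literature.Barriers.Langlands.PatchingLocalComponentBarrier: threatens B_w only (local deformation
rings at v ∣ p); S and N concern representations that already exist.
- Negatives index: t

History (route lifecycle, newest last):
- 2026-08-30T02:20:55Z · rev 2: restated Assembly (stmt-Langlands-23604) — decomp-langlands lens-6 MonodromyCarving slot-in A (crit-1 CLEARED rows 9/12): N = MonodromyUpgrade (23599) carved along MonodromyNotClosedUnderPadicLimits into (planner-decomp-langlands-writer-1-g0-0)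

sub-problem: Langlands · status: draft · opened planner-decomp-langlands-writer-1-g0-0 2026-08-30T01:25:19Z · rev 5 · ledger route-Langlands-RootDecomp1
GENERATED by the gate from the ledger (D-0016/17). Provers cite these decls: `theorem foo : Summit.Langlands.Langlands.Theses.RootDecomp1.<Decl> := …` in Summits/Langlands/Langlands/Theorems/<Name>.lean.
-/

namespace Summit.Langlands.Langlands.Theses.RootDecomp1

open scoped BigOperators Topology Manifold Classical MeasureTheory ProbabilityTheory Matrix InnerProductSpace ComplexConjugate ContinuousMap
open Filter Set Function TopologicalSpace MeasureTheory

attribute [summit_statement] _root_.Langlands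

/-- item stmt-Langlands-17414 · crux · rank 2 · open
refined by: route-Langlands-HodgeTatePurityCarving [split, draft] · by planner
why it might fail: Automorphy lifting exists only for regular, residually adequate ρ over TR/CM fields and gives POTENTIAL automorphy (BLGGT 4.2.1, ten-author 6.1.1); irregular weights / general K have no engine even for n = 2.
sources: FontaineMazurGeometric1995, BuzzardGeeLMS2014, ACCGHLNSTT2023, BarnetlambEtAl2014, Kisin2009
[crux] B_w — Fontaine–Mazur–Langlands, almost-everywhere form, for every number field K and n ≥ 1:
every irreducible ρ : Γ_K → GL_n(ℚ̄_ℓ) that is unramified a.e. and de Rham above ℓ (Fontaine's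
pinned datum) is Satake–Frobenius compatible at almost all places with some L-algebraic cuspidal π
of GL_n(𝔸_K). Verbatim the statement `weakAutomorphy_of_stubs` of line `Sketch` of crux
stmt-Langlands-14328 (there derived from the Literature text lang.S03). Rec-free. [difficulty:
open-problem] -/
@[route_item "route-Langlands-RootDecomp1", crux]
def WeakGeometricAutomorphy : Prop :=
  ∀ (K : Type) [Field K] [NumberField K] (n : ℕ) (hcpt : Literature.NumberTheory.Automorphic.isCompact_glFiniteIntegralLevel n K), 0 < n → ∀ (ℓ : ℕ) [Fact ℓ.Prime] (ι : PadicAlgCl ℓ ≃+* ℂ) (ρ : Literature.NumberTheory.GaloisRepresentations.FramedGaloisRep K (PadicAlgCl ℓ) n), ρ.toGaloisRep.IsIrreducible → ((∀ᶠ v : IsDedekindDomain.HeightOneSpectrum (NumberField.RingOfIntegers K) in cofinite, ρ.IsUnramifiedAt v) ∧ ∀ (v : IsDedekindDomain.HeightOneSpectrum (NumberField.RingOfIntegers K)) (hv : ((ℓ : ℕ) : NumberField.RingOfIntegers K) ∈ v.asIdeal), (Literature.NumberTheory.PAdicHodge.fontainePstAdicCompletion v ℓ hv).IsDeRhamFramed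 (ρ.toLocal v)) → ∃ π : Literature.NumberTheory.Automorphic.CuspidalAutomorphicRepData n K hcpt, π.1.IsLAlgebraic ∧ ∀ᶠ v : IsDedekindDomain.HeightOneSpectrum (NumberField.RingOfIntegers K) in cofinite, SatakeFrobCompatibleAt ι π.1 ρ v

/-- item stmt-Langlands-23598 · crux · rank 3 · SPLIT (gen 1) into DarkPrimitiveAvatars, AccessibleAvatars, AvatarDescent, RestrictionTwistTransport, InductionTransport, DualTransport + glue SemisimpleAvatar_of_split · direct attempts still welcome (low priority)
reduced to route-Langlands-FunctorialPrimitivitySplit: FunctoriallyPrimitiveDark, FunctoriallyPrimitiveAccessible · residual FunctoriallyPrimitiveDark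
refined by: route-Langlands-FunctorialPrimitivitySplit [split, draft] · by planner
why it might fail: No construction of any Galois representation for irregular L-algebraic π (Maass-type infinity components) or for K neither totally real nor CM — no Shimura variety or shtuka realises them.
sources: HarrisLanTaylorThorneRMS2016, Scholze2015, BuzzardGeeLMS2014, Clozel1990AnnArbor
[crux] [NEW root-level piece, the existence half of W⁺; verbatim the registered stub
`Summit.Langlands.Langlands.Cruxes.SectorComplement.BirthSatakeAvatarExistence.stub_semisimpleAvatar`;
WEAKER than W⁺ (drops irreducibility) and than Langlands; leaf IDEA-NEEDED,
BARRIER(Literature.Barriers.Langlands.ShimuraVarietyRealizationBarrier, NonRegularWeightBarrier) on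
the irregular / general-K sector, RA ∧ TR/CM sector closed-mod-print by the fact
`Literature.NumberTheory.Automorphic.exists_galoisRep_of_regularAlgebraic` (lang.S27; C- vs
L-normalisation transport `arithFrobPolyOfSatake ι q n α` ↔ `… 1 α` to be supplied); critic: CLEARED
decomp-langlands-crit-1-g0 0 2026-08-30T01:15:58Z (pub/decomp-langlands/STATUS.md; CRITIC-LEDGER.md
row 01:15:58Z)] for every number field K, n ≥ 1, every L-algebraic cuspidal π of GL_n(𝔸_K) and every
(ℓ, ι) there is a SEMISIMPLE framed ρ : Γ_K → GL_n(ℚ̄_ℓ) Satake–Frobenius compatible with (π, ι) at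
almost all places. [difficulty: open-problem] -/
@[route_item "route-Langlands-RootDecomp1", crux]
def SemisimpleAvatar : Prop :=
  ∀ (K : Type) [Field K] [NumberField K] (n : ℕ) (hcpt : Literature.NumberTheory.Automorphic.isCompact_glFiniteIntegralLevel n K), 0 < n → ∀ (π : Literature.NumberTheory.Automorphic.CuspidalAutomorphicRepData n K hcpt), π.1.IsLAlgebraic → ∀ (ℓ : ℕ) [Fact ℓ.Prime] (ι : PadicAlgCl ℓ ≃+* ℂ), ∃ ρ : Literature.NumberTheory.GaloisRepresentations.FramedGaloisRep K (PadicAlgCl ℓ) n, ρ.toGaloisRep.IsSemisimple ∧ ∀ᶠ v : IsDedekindDomain.HeightOneSpectrum (NumberField.RingOfIntegers K) in cofinite, SatakeFrobCompatibleAt ι π.1 ρ v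

-- parent: SemisimpleAvatar · child (gen 1)
/--     item stmt-Langlands-29147 · crux · rank 301 · open
    parent: SemisimpleAvatar
    reduced to route-Langlands-CyclicDeinductionCarving: ConjugateUnmixing, InsolubleDarkAvatars, AccessibleAvatars, IntegralFrobeniusData, DeterminantTowerAvatars, AvatarDescent, PrimeCyclicLayerDescent, AnabelianLayerDescent · residual InsolubleDarkAvatars
    refined by: route-Langlands-CyclicDeinductionCarving [split, draft] · by planner
    why it might fail: Not false short of ¬Langlands (E ⇒ G in kernel); as a TARGET no construction of Galois representations is known over any field with [K:K⁺] ≥ 3 for any n ≥ 2 (BCGP 1812.09269 p.4) once base change, twist and induction from accessible data are excluded, as here.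
    sources: BoxerEtAl2021, CalegariGeraghty2018, HarrisLanTaylorThorne2016, Scholze2015, ArthurClozel1989, arXiv:1812.09269
[crux] [DECLARED RESIDUAL of this route · NEW] G = E for the cuspidal L-algebraic π of GL_n/K that
are NOT SPECIAL, the dial being the LEAST class of automorphic representations (inlined
impredicatively: «π lies in every class S that (acc) contains every representation over a field with
archimedean defect d = [K:K⁺] ≤ 2, (up) is closed under a.e.-twisted weak base change up along any
K₀ ⊆ M from a cuspidal L-algebraic member by an L-algebraic automorphic character of GL₁/M, (down)
contains π whenever one cuspidal L-algebraic a.e. weak base change of π to a finite overfield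
(Arthur–Clozel Ch. 3 (1.1), `IsWeakBaseChangeLiftAE`) lies in S, (ai) is closed under automorphic
induction from a cuspidal L-algebraic member over any finite overfield (Arthur–Clozel Ch. 3 Def.
6.1, `IsAutomorphicInductionAlong`)») — so K is dark (d(K) ≥ 3, kernel
`three_le_aiDefect_of_not_isSpecial`) and π is unreachable from every accessible field by any word
in the three moves: a semisimple ℓ-adic ρ Satake–Frobenius compatible with π a.e. WEAKER than E
(kernel `darkPrimitiveAvatars_of_semisimpleAvatar`; probes G ⇏ E, G ⇏ Langlands FAIL; BC7 CLEAN).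
ORBIT-CLOSED BY CONSTRUCTION (the dial is itself saturated: k -/
@[route_item "route-Langlands-RootDecomp1", crux]
def DarkPrimitiveAvatars : Prop :=
  ∀ (K : Type) [Field K] [NumberField K] (n : ℕ) (hcpt : Literature.NumberTheory.Automorphic.isCompact_glFiniteIntegralLevel n K), 0 < n → ∀ (π : Literature.NumberTheory.Automorphic.CuspidalAutomorphicRepData n K hcpt), π.1.IsLAlgebraic → ¬ (∀ S : (∀ (K : Type) [Field K] [NumberField K] (n : ℕ) (hcpt : Literature.NumberTheory.Automorphic.isCompact_glFiniteIntegralLevel n K), Literature.NumberTheory.Automorphic.AutomorphicRepData (Literature.NumberTheory.Automorphic.AutomorphyDatum.gl n K hcpt) → Prop), ((∀ (K : Type) [Field K] [NumberField K] (n : ℕ) (hcpt : Literature.NumberTheory.Automorphic.isCompact_glFiniteIntegralLevel n K) (π : Literature.NumberTheory.Automorphic.AutomorphicRepData (Literature.NumberTheory.Automorphic.AutomorphyDatum.gl n K hcpt)), Module.finrank (NumberField.maximalRealSubfield K) K ≤ 2 → S K n hcpt π) ∧ (∀ (K₀ : Type) [Field K₀] [NumberField K₀] (M : Type) [Field M]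 [NumberField M] [Algebra K₀ M] (n : ℕ) (h₀ : Literature.NumberTheory.Automorphic.isCompact_glFiniteIntegralLevel n K₀) (hM : Literature.NumberTheory.Automorphic.isCompact_glFiniteIntegralLevel n M) (h₁ : Literature.NumberTheory.Automorphic.isCompact_glFiniteIntegralLevel 1 M) (π₀ : Literature.NumberTheory.Automorphic.CuspidalAutomorphicRepData n K₀ h₀) (χ : Literature.NumberTheory.Automorphic.AutomorphicRepData (Literature.NumberTheory.Automorphic.AutomorphyDatum.gl 1 M h₁)) (P : Literature.NumberTheory.Automorphic.AutomorphicRepData (Literature.NumberTheory.Automorphic.AutomorphyDatum.gl n M hM)), π₀.1.IsLAlgebraic → χ.IsLAlgebraic → (∀ᶠ w : IsDedekindDomain.HeightOneSpectrum (NumberField.RingOfIntegers M) in cofinite, ∀ (u : IsDedekindDomain.HeightOneSpectrum (NumberField.RingOfIntegers K₀)) (α : Multiset ℂ) (c : ℂ), w.asIdeal.under (NumberField.RingOfIntegers K₀) = u.asIdeal → π₀.1.HasSatakeParamAt u α → χ.HasSatakeParamAt w {c} → P.HasSatakeParamAt w ((α.map (· ^ w.asIdeal.inertiaDeg (NumberField.RingOfIntegers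 K₀))).map (c * ·))) → S K₀ n h₀ π₀.1 → S M n hM P) ∧ (∀ (K : Type) [Field K] [NumberField K] (M : Type) [Field M] [NumberField M] [Algebra K M] (n : ℕ) (hcpt : Literature.NumberTheory.Automorphic.isCompact_glFiniteIntegralLevel n K) (hM : Literature.NumberTheory.Automorphic.isCompact_glFiniteIntegralLevel n M) (π : Literature.NumberTheory.Automorphic.AutomorphicRepData (Literature.NumberTheory.Automorphic.AutomorphyDatum.gl n K hcpt)) (P : Literature.NumberTheory.Automorphic.CuspidalAutomorphicRepData n M hM), P.1.IsLAlgebraic → Literature.NumberTheory.Automorphic.IsWeakBaseChangeLiftAE π P.1 → S M n hM P.1 → S K n hcpt π) ∧ (∀ (K : Type) [Field K] [NumberField K] (L : Type) [Field L] [NumberField L] [Algebra K L] (m n : ℕ) (hL : Literature.NumberTheory.Automorphic.isCompact_glFiniteIntegralLevel m L) (hcpt : Literature.NumberTheory.Automorphic.isCompact_glFiniteIntegralLevel n K) (σ : Literature.NumberTheory.Automorphic.CuspidalAutomorphicRepData m L hL) (π : Literature.NumberTheory.Automorphic.AutomorphicRepData (Literature.NumberTheory.Automorphic.AutomorphyDatum.gl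 n K hcpt)), 0 < m → σ.1.IsLAlgebraic → (∀ᶠ v : IsDedekindDomain.HeightOneSpectrum (NumberField.RingOfIntegers K) in cofinite, ∀ β : IsDedekindDomain.HeightOneSpectrum (NumberField.RingOfIntegers L) → Multiset ℂ, (∀ w : IsDedekindDomain.HeightOneSpectrum (NumberField.RingOfIntegers L), w.asIdeal.under (NumberField.RingOfIntegers K) = v.asIdeal → σ.1.HasSatakeParamAt w (β w)) → ∃ α : Multiset ℂ, π.HasSatakeParamAt v α ∧ Literature.NumberTheory.Automorphic.satakePolynomial α = ∏ᶠ w ∈ {w : IsDedekindDomain.HeightOneSpectrum (NumberField.RingOfIntegers L) | w.asIdeal.under (NumberField.RingOfIntegers K) = v.asIdeal}, (Literature.NumberTheory.Automorphic.satakePolynomial (β w)).comp (Polynomial.X ^ w.asIdeal.inertiaDeg (NumberField.RingOfIntegers K))) → S L m hL σ.1 → S K n hcpt π) ∧ (∀ (K : Type) [Field K] [NumberField K] (n : ℕ) (hcpt : Literature.NumberTheory.Automorphic.isCompact_glFiniteIntegralLevel n K) (π : Literature.NumberTheory.Automorphic.CuspidalAutomorphicRepData n K hcpt) (P : Literature.NumberTheory.Automorphic.AutomorphicRepData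 (Literature.NumberTheory.Automorphic.AutomorphyDatum.gl n K hcpt)), π.1.IsLAlgebraic → (∀ᶠ v : IsDedekindDomain.HeightOneSpectrum (NumberField.RingOfIntegers K) in cofinite, ∀ α : Multiset ℂ, π.1.HasSatakeParamAt v α → P.HasSatakeParamAt v (α.map (·⁻¹))) → S K n hcpt π.1 → S K n hcpt P)) → S K n hcpt π.1) → ∀ (ℓ : ℕ) [Fact ℓ.Prime] (ι : PadicAlgCl ℓ ≃+* ℂ), ∃ ρ : Literature.NumberTheory.GaloisRepresentations.FramedGaloisRep K (PadicAlgCl ℓ) n, ρ.toGaloisRep.IsSemisimple ∧ ∀ᶠ v : IsDedekindDomain.HeightOneSpectrum (NumberField.RingOfIntegers K) in cofinite, SatakeFrobCompatibleAt ι π.1 ρ v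

-- parent: SemisimpleAvatar · child (gen 1)
/--     item stmt-Langlands-29148 · crux · rank 302 · open
    parent: SemisimpleAvatar
    reduced to route-Langlands-DeterminantTowerSplit: IntegralFrobeniusData, DeterminantTowerAvatars · residual DeterminantTowerAvatars
    refined by: route-Langlands-DeterminantTowerSplit [split, draft] · by planner
    why it might fail: Not false short of ¬Langlands; the risk is emptiness of method beyond the print cells: irregular π (weight barrier B1 bites INSIDE this cell) and n ≥ 3 over mixed-signature quadratic fields have no known construction (BCGP 1812.09269 §1.1, p.4).
    sources: HarrisLanTaylorThorne2016, Scholze2015, BoxerEtAl2021, VarmaFMS2024, HarrisSoudryTaylor1993, Taylor1994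
[crux] [NEW] Acc = E verbatim over ACCESSIBLE base fields, d(K) = [K : K⁺] ≤ 2 (K⁺ = maximal real
subfield; inlined as `Module.finrank (NumberField.maximalRealSubfield K) K ≤ 2`): totally real (d =
1), CM (d = 2) AND mixed-signature quadratic extensions of totally real fields such as ℚ(⁴√2) ⊃
ℚ(√2) (d = 2) — literally the complement of the Narrow realisation barrier’s blocked class
(`Literature.Barriers.Langlands.ShimuraVarietyRealizationBarrierNarrow_holds : OddPairing (aiDefect
K) ↔ aiDefect K ≤ 2`). For every n ≥ 1, every cuspidal L-algebraic π of GL_n/K and every (ℓ, ι): a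
semisimple ℓ-adic ρ Satake–Frobenius compatible with π at almost every place. WEAKER than E (kernel
`accessibleAvatars_of_semisimpleAvatar`; probes Acc ⇏ E / Langlands FAIL; BC7 CLEAN). ATTACKABLE:
regular algebraic π over TR/CM (Harris–Lan–Taylor–Thorne, Scholze; local-global Varma), n = 2
low/partial weight over TR and over ANY quadratic extension of a TR field (BCGP arXiv:1812.09269
§2.7, §10), n = 2 over imaginary quadratic fields (Harris–Soudry–Taylor, Taylor, Berger–Harcos).
Open inside: irregular π (weight barrier `NonRegularWeightBarrier_holds` bites INSIDE the cell —
lens-2 g0 axis, not cut here), n -/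
@[route_item "route-Langlands-RootDecomp1", crux]
def AccessibleAvatars : Prop :=
  ∀ (K : Type) [Field K] [NumberField K] (n : ℕ) (hcpt : Literature.NumberTheory.Automorphic.isCompact_glFiniteIntegralLevel n K), 0 < n → Module.finrank (NumberField.maximalRealSubfield K) K ≤ 2 → ∀ (π : Literature.NumberTheory.Automorphic.CuspidalAutomorphicRepData n K hcpt), π.1.IsLAlgebraic → ∀ (ℓ : ℕ) [Fact ℓ.Prime] (ι : PadicAlgCl ℓ ≃+* ℂ), ∃ ρ : Literature.NumberTheory.GaloisRepresentations.FramedGaloisRep K (PadicAlgCl ℓ) n, ρ.toGaloisRep.IsSemisimple ∧ ∀ᶠ v : IsDedekindDomain.HeightOneSpectrum (NumberField.RingOfIntegers K) in cofinite, SatakeFrobCompatibleAt ι π.1 ρ v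

-- parent: SemisimpleAvatar · child (gen 1)
/--     item stmt-Langlands-29149 · crux · rank 303 · open
    parent: SemisimpleAvatar
    reduced to route-Langlands-CyclicLayerPeeling: PrimeCyclicLayerDescent, AnabelianLayerDescent, SelfTwistedLayerDescent · residual AnabelianLayerDescent
    refined by: route-Langlands-CyclicLayerPeeling [split, draft] · by planner
    why it might fail: As typed (ANY finite M/K, r only semisimple) it may FAIL: for reducible r or non-normal M/K the weak base change need not pin the twist class of a descent at inert places; repair = «M/K cyclic of prime degree» or «r irreducible». Print has it only for strongly-∅-general FAMILIES (1306.1242 §1).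
    sources: PatrikisTaylor2015, ArthurClozel1989, HarrisLanTaylorThorne2016, Rajan1999, arXiv:1306.1242
[crux] [NEW ATOM · UNDECIDED-with-test · IDEA-NEEDED · no catalogued barrier] AvDesc = SINGLE-LAYER
DESCENT OF AVATARS on the automorphic-to-Galois side: for π cuspidal L-algebraic on GL_n/K, ANY
finite extension M/K (an `Algebra K M` of number fields), any cuspidal L-algebraic P on GL_n/M that
is an a.e. weak base change of π (`IsWeakBaseChangeLiftAE`, Arthur–Clozel (1.1)) and any SEMISIMPLE
ℓ-adic r over M Satake–Frobenius compatible with P a.e.: a semisimple ℓ-adic ρ over K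
Satake–Frobenius compatible with π a.e. WEAKER than E (kernel `avatarDescent_of_semisimpleAvatar`: E
supplies ρ directly; probes AvDesc ⇏ E / Langlands FAIL; BC7 CLEAN). In print ONLY for
strongly-∅-general FAMILIES of (M, P, r) (Blasius–Rogawski / Sorensen patching lemma;
Patrikis–Taylor arXiv:1306.1242 §1 pp. 12–13; the HLTT descent CM → TR), never for ONE layer: for
cyclic M/K and r irreducible a Clifford extension to Γ_K exists, but the twist class matching π at
the inert places is not forced (π and π ⊗ η_{M/K} have the same base change). TEST that decides the
tag: exhibit a print theorem descending an avatar of BC_{M/K}(π) to π for ONE quadratic M without a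
family ⇒ re-tag ATTACKABLE; none found (searche -/
@[route_item "route-Langlands-RootDecomp1", crux]
def AvatarDescent : Prop :=
  ∀ (K : Type) [Field K] [NumberField K] (n : ℕ) (hcpt : Literature.NumberTheory.Automorphic.isCompact_glFiniteIntegralLevel n K), 0 < n → ∀ (π : Literature.NumberTheory.Automorphic.CuspidalAutomorphicRepData n K hcpt), π.1.IsLAlgebraic → ∀ (M : Type) [Field M] [NumberField M] [Algebra K M] (hM : Literature.NumberTheory.Automorphic.isCompact_glFiniteIntegralLevel n M) (P : Literature.NumberTheory.Automorphic.CuspidalAutomorphicRepData n M hM), P.1.IsLAlgebraic → Literature.NumberTheory.Automorphic.IsWeakBaseChangeLiftAE π.1 P.1 → ∀ (ℓ : ℕ) [Fact ℓ.Prime] (ι : PadicAlgCl ℓ ≃+* ℂ) (r : Literature.NumberTheory.GaloisRepresentations.FramedGaloisRep M (PadicAlgCl ℓ) n), r.toGaloisRep.IsSemisimple → (∀ᶠ w : IsDedekindDomain.HeightOneSpectrum (NumberField.RingOfIntegers M) in cofinite, SatakeFrobCompatibleAt ι P.1 r w) → ∃ ρ : Literature.NumberTheory.GaloisRepresentations.FramedGaloisRep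 K (PadicAlgCl ℓ) n, ρ.toGaloisRep.IsSemisimple ∧ ∀ᶠ v : IsDedekindDomain.HeightOneSpectrum (NumberField.RingOfIntegers K) in cofinite, SatakeFrobCompatibleAt ι π.1 ρ v

-- parent: SemisimpleAvatar · child (gen 1)
/--     item stmt-Langlands-29150 · support · rank 304 · open
    parent: SemisimpleAvatar · by planner
    why it might fail: Routine modulo print; a typing slip could only sit in the inertia-degree exponent or the twist normalisation of the inlined a.e.-twisted base-change clause (unit vs arithmetic Frobenius).
    sources: ArthurClozel1989, SerreAbelianLadic1968, HarrisLanTaylorThorne2016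
[support] [CLOSED-MOD-PRINT · first prover target] RTT = avatars ascend and twist: for K₀ ⊆ M number
fields, π₀ cuspidal L-algebraic on GL_n/K₀, χ an L-algebraic automorphic character of GL₁/M and P
cuspidal L-algebraic on GL_n/M an a.e.-TWISTED weak base change of π₀ by χ (inlined: at a.e. w ∣ u,
Satake(P, w) = c_w · Satake(π₀, u)^{f(w|u)}), a semisimple avatar ρ₀ of π₀ yields a semisimple
avatar of P — namely ρ₀|Γ_M ⊗ χ_gal. Restriction bookkeeping PROVED in the tree for all n
(`Literature.NumberTheory.Automorphic.hasFrobCharpolyAt_restrictField_arithFrobPolyOfSatake`,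
`isGaloisCompatibleAt_restrictField`, `FramedGaloisRep.isUnramifiedAt_restrictField`); the ℓ-adic
character of an L-algebraic Hecke character is Weil 1956 / Serre 1968; semisimplicity of a
finite-index restriction and of a twist is Clifford. WEAKER than E (kernel
`restrictionTwistTransport_of_semisimpleAvatar`); it is the UP-transport that makes the dial
orbit-closed — the DOWN-transport is the open crux AvatarDescent (the (A)-side asymmetry this node
types). NODE decomp-langlands-lens-6-g4 (HOME/STATUS.md; nodes/lens-6-g4-AIDefectCarving.lean rc 0 ·
0 sorry · std axioms; probes nodes/lens-6-g4-AIDefectCarving.prob -/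
@[route_item "route-Langlands-RootDecomp1", crux]
def RestrictionTwistTransport : Prop :=
  ∀ (K₀ : Type) [Field K₀] [NumberField K₀] (M : Type) [Field M] [NumberField M] [Algebra K₀ M] (n : ℕ) (h₀ : Literature.NumberTheory.Automorphic.isCompact_glFiniteIntegralLevel n K₀) (hM : Literature.NumberTheory.Automorphic.isCompact_glFiniteIntegralLevel n M) (h₁ : Literature.NumberTheory.Automorphic.isCompact_glFiniteIntegralLevel 1 M), 0 < n → ∀ (π₀ : Literature.NumberTheory.Automorphic.CuspidalAutomorphicRepData n K₀ h₀) (χ : Literature.NumberTheory.Automorphic.AutomorphicRepData (Literature.NumberTheory.Automorphic.AutomorphyDatum.gl 1 M h₁)) (P : Literature.NumberTheory.Automorphic.CuspidalAutomorphicRepData n M hM), π₀.1.IsLAlgebraic → χ.IsLAlgebraic → P.1.IsLAlgebraic → (∀ᶠ w : IsDedekindDomain.HeightOneSpectrum (NumberField.RingOfIntegers M) in cofinite, ∀ (u : IsDedekindDomain.HeightOneSpectrum (NumberField.RingOfIntegers K₀)) (α : Multiset ℂ) (c : ℂ), w.asIdeal.under (NumberField.RingOfIntegers K₀) = u.asIdeal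 → π₀.1.HasSatakeParamAt u α → χ.HasSatakeParamAt w {c} → P.1.HasSatakeParamAt w ((α.map (· ^ w.asIdeal.inertiaDeg (NumberField.RingOfIntegers K₀))).map (c * ·))) → ∀ (ℓ : ℕ) [Fact ℓ.Prime] (ι : PadicAlgCl ℓ ≃+* ℂ) (ρ₀ : Literature.NumberTheory.GaloisRepresentations.FramedGaloisRep K₀ (PadicAlgCl ℓ) n), ρ₀.toGaloisRep.IsSemisimple → (∀ᶠ u : IsDedekindDomain.HeightOneSpectrum (NumberField.RingOfIntegers K₀) in cofinite, SatakeFrobCompatibleAt ι π₀.1 ρ₀ u) → ∃ r : Literature.NumberTheory.GaloisRepresentations.FramedGaloisRep M (PadicAlgCl ℓ) n, r.toGaloisRep.IsSemisimple ∧ ∀ᶠ w : IsDedekindDomain.HeightOneSpectrum (NumberField.RingOfIntegers M) in cofinite, SatakeFrobCompatibleAt ι P.1 r w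

-- parent: SemisimpleAvatar · child (gen 1)
/--     item stmt-Langlands-29151 · support · rank 305 · open
    parent: SemisimpleAvatar · by planner
    why it might fail: Routine modulo print; the only typing risk is the normalisation of the induced Satake relation (arithmetic vs geometric Frobenius in `arithFrobPolyOfSatake`) against `inducedSatakePolynomial` — both are the tree’s own conventions.
    sources: ArthurClozel1989, SerreAbelianLadic1968
[support] [CLOSED-MOD-PRINT] AIT = avatars induce: for K ⊆ L number fields, σ cuspidal L-algebraic
on GL_m/L (m ≥ 1) and π cuspidal L-algebraic on GL_n/K automorphically induced a.e. from σ
(`Literature.NumberTheory.Automorphic.IsAutomorphicInductionAlong σ.1 π.1`, Arthur–Clozel Ch. 3 Def.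
6.1 for an arbitrary finite extension; it forces n = m[L:K], `IsAutomorphicInductionAlong.rank_eq`),
a semisimple avatar r of σ over L yields a semisimple avatar of π over K — namely Ind_{Γ_L}^{Γ_K} r,
whose Frobenius polynomial at an unramified v is ∏_{w∣v} charpoly(r, Frob_w).comp(X^{f(w|v)}) = the
tree’s `inducedSatakePolynomial` (Mackey); semisimple by Clifford/Maschke in characteristic 0.
WEAKER than E (kernel `inductionTransport_of_semisimpleAvatar`). It is the transport along the (ai)
move of the dial — the reason monomial representations over dark fields are NOT in the residual.
NODE decomp-langlands-lens-6-g4 (HOME/STATUS.md; nodes/lens-6-g4-AIDefectCarving.lean rc 0 · 0 sorry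
· std axioms; probes nodes/lens-6-g4-AIDefectCarving.probes.lean rc 0, BC7 6/6 CLEAN); critic:
PENDING (decomp-langlands-crit-1) TAGS (crit-1 CLEARED 2026-08-30T06:14:06Z STATUS L236,
CRITIC-LEDGER row 56; census o -/
@[route_item "route-Langlands-RootDecomp1", crux]
def InductionTransport : Prop :=
  ∀ (K : Type) [Field K] [NumberField K] (L : Type) [Field L] [NumberField L] [Algebra K L] (m n : ℕ) (hL : Literature.NumberTheory.Automorphic.isCompact_glFiniteIntegralLevel m L) (hcpt : Literature.NumberTheory.Automorphic.isCompact_glFiniteIntegralLevel n K), 0 < m → 0 < n → ∀ (σ : Literature.NumberTheory.Automorphic.CuspidalAutomorphicRepData m L hL) (π : Literature.NumberTheory.Automorphic.CuspidalAutomorphicRepData n K hcpt), σ.1.IsLAlgebraic → π.1.IsLAlgebraic → (∀ᶠ v : IsDedekindDomain.HeightOneSpectrum (NumberField.RingOfIntegers K) in cofinite, ∀ β : IsDedekindDomain.HeightOneSpectrum (NumberField.RingOfIntegers L) → Multiset ℂ, (∀ w : IsDedekindDomain.HeightOneSpectrum (NumberField.RingOfIntegers L), w.asIdeal.under (NumberField.RingOfIntegers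 K) = v.asIdeal → σ.1.HasSatakeParamAt w (β w)) → ∃ α : Multiset ℂ, π.1.HasSatakeParamAt v α ∧ Literature.NumberTheory.Automorphic.satakePolynomial α = ∏ᶠ w ∈ {w : IsDedekindDomain.HeightOneSpectrum (NumberField.RingOfIntegers L) | w.asIdeal.under (NumberField.RingOfIntegers K) = v.asIdeal}, (Literature.NumberTheory.Automorphic.satakePolynomial (β w)).comp (Polynomial.X ^ w.asIdeal.inertiaDeg (NumberField.RingOfIntegers K))) → ∀ (ℓ : ℕ) [Fact ℓ.Prime] (ι : PadicAlgCl ℓ ≃+* ℂ) (r : Literature.NumberTheory.GaloisRepresentations.FramedGaloisRep L (PadicAlgCl ℓ) m), r.toGaloisRep.IsSemisimple → (∀ᶠ w : IsDedekindDomain.HeightOneSpectrum (NumberField.RingOfIntegers L) in cofinite, SatakeFrobCompatibleAt ι σ.1 r w) → ∃ ρ : Literature.NumberTheory.GaloisRepresentations.FramedGaloisRep K (PadicAlgCl ℓ) n, ρ.toGaloisRep.IsSemisimple ∧ ∀ᶠ v : IsDedekindDomain.HeightOneSpectrum (NumberField.RingOfIntegers K) in cofinite, SatakeFrobCompatibleAt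 ι π.1 ρ v

-- parent: SemisimpleAvatar · child (gen 1)
/--     item stmt-Langlands-29152 · support · rank 306 · closed · proved by Summit.Langlands.Langlands.Theorems.dualTransport_proof (prover)
    parent: SemisimpleAvatar · by planner
    why it might fail: Routine modulo print; the only typing risk is the convention pairing `arithFrobPolyOfSatake ι q 1 (α.map (·⁻¹))` with the characteristic polynomial of the dual representation (unit-root normalisation of L-algebraic Satake parameters).
    sources: SerreAbelianLadic1968, ArthurClozel1989
[support] [CLOSED-MOD-PRINT] DT = avatars dualise: for π, P cuspidal L-algebraic on GL_n/K with P an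
a.e. CONTRAGREDIENT of π (inlined: at almost every place the Satake parameter of P is the inverse
multiset of that of π), a semisimple avatar ρ of π yields a semisimple avatar of P — namely the dual
ρ^∨ (characteristic polynomial of ρ^∨(Frob_v) = the reciprocal polynomial, roots inverted). WEAKER
than E (kernel `dualTransport_of_semisimpleAvatar`); print (linear algebra). It is the transport
along the (dual) move of the dial, listed because census G2 names duals among the print transfers
under which a dial must be orbit-closed. NODE decomp-langlands-lens-6-g4 (HOME/STATUS.md;
nodes/lens-6-g4-AIDefectCarving.lean rc 0 · 0 sorry · std axioms; probes
nodes/lens-6-g4-AIDefectCarving.probes.lean rc 0, BC7 6/6 CLEAN); critic: PENDING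
(decomp-langlands-crit-1) TAGS (crit-1 CLEARED 2026-08-30T06:14:06Z STATUS L236, CRITIC-LEDGER row
56; census of record HOME/census/COSTUME-CENSUS-v7.md sha256
fc8808a5e042a96cef2dbbbdc16f6b886c67ecbcf1e31605c3c6d210d1a62770 (json 7990a901…174e; row F03 = E
23598); v8 announced L227): DT = avatars DUALISE (ρ^∨ along a.e. contragredients, Satake parameters
α ↦ -/
@[route_item "route-Langlands-RootDecomp1"]
def DualTransport : Prop :=
  ∀ (K : Type) [Field K] [NumberField K] (n : ℕ) (hcpt : Literature.NumberTheory.Automorphic.isCompact_glFiniteIntegralLevel n K), 0 < n → ∀ (π P : Literature.NumberTheory.Automorphic.CuspidalAutomorphicRepData n K hcpt), π.1.IsLAlgebraic → P.1.IsLAlgebraic → (∀ᶠ v : IsDedekindDomain.HeightOneSpectrum (NumberField.RingOfIntegers K) in cofinite, ∀ α : Multiset ℂ, π.1.HasSatakeParamAt v α → P.1.HasSatakeParamAt v (α.map (·⁻¹))) → ∀ (ℓ : ℕ) [Fact ℓ.Prime] (ι : PadicAlgCl ℓ ≃+* ℂ) (ρ : Literature.NumberTheory.GaloisRepresentations.FramedGaloisRep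 K (PadicAlgCl ℓ) n), ρ.toGaloisRep.IsSemisimple → (∀ᶠ v : IsDedekindDomain.HeightOneSpectrum (NumberField.RingOfIntegers K) in cofinite, SatakeFrobCompatibleAt ι π.1 ρ v) → ∃ r : Literature.NumberTheory.GaloisRepresentations.FramedGaloisRep K (PadicAlgCl ℓ) n, r.toGaloisRep.IsSemisimple ∧ ∀ᶠ v : IsDedekindDomain.HeightOneSpectrum (NumberField.RingOfIntegers K) in cofinite, SatakeFrobCompatibleAt ι P.1 r v

-- `DualTransport` holds: proved by `Summit.Langlands.Langlands.Theorems.dualTransport_proof` (its module imports this route file, so no `_holds` link can be stated here).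

-- parent: SemisimpleAvatar · glue (gen 1)
/--     item stmt-Langlands-29153 · support · rank 307 · closed · proved by Summit.Langlands.Langlands.Theorems.SemisimpleAvatar_of_split_proof (prover)
    parent: SemisimpleAvatar · GLUE: children ⟹ parent · by planner
DarkPrimitiveAvatars → AccessibleAvatars → AvatarDescent → RestrictionTwistTransport →
InductionTransport → DualTransport → SemisimpleAvatar -/
@[route_item "route-Langlands-RootDecomp1"]
def SemisimpleAvatar_of_split : Prop :=
  DarkPrimitiveAvatars → AccessibleAvatars → AvatarDescent → RestrictionTwistTransport → InductionTransport → DualTransport → SemisimpleAvatar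

-- `SemisimpleAvatar_of_split` holds: proved by `Summit.Langlands.Langlands.Theorems.SemisimpleAvatar_of_split_proof` (its module imports this route file, so no `_holds` link can be stated here).

/-- item stmt-Langlands-25107 · crux · rank 4 · open · by planner
why it might fail: open content of local–global compatibility: for regular non-polarizable π over CM only WD ≺ rec is known (Varma 2024, AHTW 2026 Cor 1.2.2); irregular π / general K: no avatar; every known off-polarizable construction is an ℓ-adic limit, and limits cannot certify the open orbit (barrier)
sources: arXiv:1411.1445, arXiv:2607.11763, AllenNewton2020, TaylorYoshida2007, Caraiani2012, Allen2016
GEN — for every number field K, n ≥ 1, L-algebraic cuspidal π of GL_n/K, prime ℓ, ι, and every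
irreducible pinned-geometric ρ : Γ_K → GL_n(ℚ̄_ℓ) Satake–Frobenius compatible with (π, ι) almost
everywhere, at every finite v ∤ ℓ: every Frobenius-semisimplification of the ℂ-transport (along ι)
of any Weil–Deligne representation attached to ρ|_Γv by the ℓ-adic (Grothendieck) recipe is GENERIC
(no nonzero q-twisted self-intertwiner commuting with N; equivalently N lies in the open orbit of
the centraliser of the Weil action, L(s, Ad r) regular at s = 1). Rec-free and π_v-free: the
intrinsic, barrier-internal half of local–global compatibility at v ∤ ℓ. TAGS (decomp-langlands
lens-6 «barrier-complement carving» node MonodromyCarving v2, nodes/lens-6-g0-MonodromyCarving.lean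
sha256 fb4bcb30…; crit-1 CLEARED 2026-08-30T01:47:33Z + 02:03:12Z, HOME/CRITIC-LEDGER.md rows 9/12;
census COSTUME-CENSUS-v1 sha256 4dd86a1c…): NEW crux · OPEN · WEAKER than N = MonodromyUpgrade
(stmt-Langlands-23599) and than Langlands (kernel `Cert.genericFibre_of_langlands : Langlands →
RecPreservesGenericity → GenericFibre`; GEN ↛ N, GEN ∧ WDU ↛ N, GEN ∧ RECGEN ↛ N probes fail) ·
ATTACKABLE on CM ∧ regular-algebrai -/
@[route_item "route-Langlands-RootDecomp1", crux]
def GenericFibre : Prop :=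
  ∀ (K : Type) [Field K] [NumberField K] (n : ℕ) (hcpt : Literature.NumberTheory.Automorphic.isCompact_glFiniteIntegralLevel n K), 0 < n → ∀ (π : Literature.NumberTheory.Automorphic.CuspidalAutomorphicRepData n K hcpt), π.1.IsLAlgebraic → ∀ (ℓ : ℕ) [Fact ℓ.Prime] (ι : PadicAlgCl ℓ ≃+* ℂ) (ρ : Literature.NumberTheory.GaloisRepresentations.FramedGaloisRep K (PadicAlgCl ℓ) n), ρ.toGaloisRep.IsIrreducible → ((∀ᶠ v : IsDedekindDomain.HeightOneSpectrum (NumberField.RingOfIntegers K) in Filter.cofinite, ρ.IsUnramifiedAt v) ∧ ∀ (v : IsDedekindDomain.HeightOneSpectrum (NumberField.RingOfIntegers K)) (hv : ((ℓ : ℕ) : NumberField.RingOfIntegers K) ∈ v.asIdeal), (Literature.NumberTheory.PAdicHodge.fontainePstAdicCompletion v ℓ hv).IsDeRhamFramed (ρ.toLocal v)) → (∀ᶠ v : IsDedekindDomain.HeightOneSpectrum (NumberField.RingOfIntegers K) in Filter.cofinite, SatakeFrobCompatibleAt ι π.1 ρ v) → ∀ v : IsDedekindDomain.HeightOneSpectrum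 (NumberField.RingOfIntegers K), ((ℓ : ℕ) : NumberField.RingOfIntegers K) ∉ v.asIdeal → ∀ (W : Literature.NumberTheory.GaloisRepresentations.WeilDeligneRep (v.adicCompletion K) (PadicAlgCl ℓ) (Fin n → PadicAlgCl ℓ)) (Wℂ r₁ : Literature.NumberTheory.GaloisRepresentations.WeilDeligneRep (v.adicCompletion K) ℂ (Fin n → ℂ)), Literature.NumberTheory.GaloisRepresentations.IsWeilDeligneOfLadic (ρ.toLocal v).toWeilGroupHom W → W.IsTransportAlong (ι : PadicAlgCl ℓ →+* ℂ) Wℂ → r₁.IsFrobSemisimplificationOf Wℂ → ∀ f : (Fin n → ℂ) →ₗ[ℂ] (Fin n → ℂ), (∀ w : Literature.NumberTheory.GaloisRepresentations.WeilGroup (v.adicCompletion K), f ∘ₗ r₁.ρ w = ((Literature.NumberTheory.GaloisRepresentations.IsNonarchimedeanLocalField.residueFieldCard (v.adicCompletion K) : ℂ) ^ (Literature.NumberTheory.GaloisRepresentations.WeilGroup.deg w)) • (r₁.ρ w ∘ₗ f)) → f ∘ₗ r₁.N = r₁.N ∘ₗ f → f = 0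

/-- item stmt-Langlands-23600 · crux · rank 5 · open
reduced to route-Langlands-IwahoriBlockSplit: IwahoriBlockMatching, UnramifiedCompatibleAvatar, MonodromicTwistMatching, NonIwahoriBlockMatching · residual IwahoriBlockMatching
refined by: route-Langlands-IwahoriBlockSplit [split, draft] · by planner
why it might fail: Known only for regular algebraic π over TR/CM K (Varma 2024; polarizable: Harris–Taylor, Taylor–Yoshida); for irregular π or general K no avatar with controlled ramified traces exists — it inherits W⁺'s construction problem at the bad places.
sources: TaylorGaloisRepresentations2004, VarmaFMS2024, HarrisTaylorAMS2001, Caraiani2012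
[crux] [NEW root-level piece S = the Weil-group half of L∤R; verbatim the registered stub
`…Cruxes.CompatibilityAwayFromLR.Birth.stub_semisimpleMatchingOneDatum`; WEAKER than L∤R (Wℂ^F-ss ≅
S preserves traces; S does not return the monodromy) and than Langlands
(`compatibilityAwayFromLR_of_langlands`); OPEN; leaf IDEA-NEEDED, «no catalogued barrier» (the
avatar's construction sector inherits ShimuraVarietyRealization / NonRegularWeight); RA ∧ CM/TR
sector closed-mod-print by the fact `Varma2024.theorem12_trace_eq_and_precI`; critic: CLEARED
crit-1-g0 2026-08-30T01:15:58Z] for every K carrying reciprocity data there is ONE pinned datum Rec₀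
such that for every L-algebraic cuspidal π of GL_n(𝔸_K), every (ℓ, ι), every irreducible
pinned-geometric ρ Satake-compatible with (π, ι) a.e. and every exceptional place v ∤ ℓ there exist
the local component π_v, a Weil–Deligne module W of ρ|_W_v (Grothendieck), its transport Wℂ along ι
and a Frobenius-semisimple S ∈ rec_Rec₀,v(π_v) with tr Wℂ = tr S on W_K_v. [deps: SemisimpleAvatar]
[difficulty: open-problem] -/
@[route_item "route-Langlands-RootDecomp1", crux]
def SemisimpleMatchingOneDatum : Prop :=
  ∀ (K : Type) [Field K] [NumberField K], Nonempty (ReciprocityData K) → ∃ Rec : ReciprocityData K, ∀ (n : ℕ) (hcpt : Literature.NumberTheory.Automorphic.isCompact_glFiniteIntegralLevel n K), 0 < n → ∀ (π : Literature.NumberTheory.Automorphic.CuspidalAutomorphicRepData n K hcpt), π.1.IsLAlgebraic → ∀ (ℓ : ℕ) [Fact ℓ.Prime] (ι : PadicAlgCl ℓ ≃+* ℂ) (ρ : Literature.NumberTheory.GaloisRepresentations.FramedGaloisRep K (PadicAlgCl ℓ) n), ρ.toGaloisRep.IsIrreducible → ((∀ᶠ v : IsDedekindDomain.HeightOneSpectrum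 (NumberField.RingOfIntegers K) in cofinite, ρ.IsUnramifiedAt v) ∧ ∀ (v : IsDedekindDomain.HeightOneSpectrum (NumberField.RingOfIntegers K)) (hv : ((ℓ : ℕ) : NumberField.RingOfIntegers K) ∈ v.asIdeal), (Literature.NumberTheory.PAdicHodge.fontainePstAdicCompletion v ℓ hv).IsDeRhamFramed (ρ.toLocal v)) → (∀ᶠ v : IsDedekindDomain.HeightOneSpectrum (NumberField.RingOfIntegers K) in cofinite, SatakeFrobCompatibleAt ι π.1 ρ v) → ∀ v : IsDedekindDomain.HeightOneSpectrum (NumberField.RingOfIntegers K), ((ℓ : ℕ) : NumberField.RingOfIntegers K) ∉ v.asIdeal → ¬ SatakeFrobCompatibleAt ι π.1 ρ v → ∃ (πv : Literature.NumberTheory.Automorphic.SmoothIrrep (Matrix.GeneralLinearGroup (Fin n) (v.adicCompletion K))) (W : Literature.NumberTheory.GaloisRepresentations.WeilDeligneRep (v.adicCompletion K) (PadicAlgCl ℓ) (Fin n → (PadicAlgCl ℓ))) (Wℂ : Literature.NumberTheory.GaloisRepresentations.WeilDeligneRep (v.adicCompletion K) ℂ (Fin n → ℂ)) (S : Literature.NumberTheory.GaloisRepresentations.WeilDeligneRep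 (v.adicCompletion K) ℂ (Fin n → ℂ)) (hS : S.IsFrobSemisimple), π.1.HasLocalComponentAt v πv.ρ ∧ Literature.NumberTheory.GaloisRepresentations.IsWeilDeligneOfLadic (ρ.toLocal v).toWeilGroupHom W ∧ W.IsTransportAlong (ι : PadicAlgCl ℓ →+* ℂ) Wℂ ∧ Quotient.mk (Literature.NumberTheory.Automorphic.frobSemisimpleWDSetoid (v.adicCompletion K) n) ⟨S, hS⟩ = (Rec.llc v).recGL n (Literature.NumberTheory.Automorphic.IrrClass.mk πv) ∧ ∀ w : Literature.NumberTheory.GaloisRepresentations.WeilGroup (v.adicCompletion K), LinearMap.trace ℂ (Fin n → ℂ) (Wℂ.ρ w) = LinearMap.trace ℂ (Fin n → ℂ) (S.ρ w)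

/-- item stmt-Langlands-17534 · crux · rank 6 · open · by planner
why it might fail: ℓ = p compatibility for torsion-limit representations is known only up to semisimplification (AHTW 2026 Thm 1.2.1, regular π over CM); the monodromy at p, irregular π and general K are open.
sources: FontaineAsterisque223VIII, Caraiani2014, AHTW2026, arXiv:math/0612077
[crux] P — the PRIME-SWITCH PRINCIPLE for the p-adic member of the automorphic compatible system
(Rec-parametric, Rec-free in content; rev 1, cone repair: stated over the summit's own predicates
only): for π L-algebraic cuspidal on GL_n/K, ρ an irreducible ℓ-adic avatar of (π, ι)
(Satake–Frobenius compatible a.e.) and a place v ∣ ℓ: (i) ρ|_v is de Rham for Fontaine's pinned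
datum; (ii) for EVERY reciprocity datum Rec, every prime ℓ' ∤ v, ι' and every irreducible ℓ'-adic
avatar ρ' of (π, ι'), local–global compatibility of (π, ρ') at v for Rec (read ℓ'-adically,
Grothendieck–Deligne) implies local–global compatibility of (π, ρ) at v for Rec (read through
D_pst). Mathematically (ii) is Fontaine's C_WD for the system {ρ_(π,ι)}: the
Frobenius-semisimplified Weil–Deligne representation at v of the p-adic member, computed by D_pst,
is the common one of the ℓ'-adic members (Saito arXiv:math/0612077 for Hilbert modular forms;
Caraiani 2012/2014 for Shimura varieties; AHTW 2026 Thm 1.2.1 up to semisimplification for regular π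
over CM). Kernel-certified consequence of `Langlands` (bc/SubsOfLanglands.lean); with L∤ at (π, ι',
ρ') it is Taylor's Conj. 7 at v ∣ ℓ — the glue's patching lemma. -/
@[route_item "route-Langlands-RootDecomp1", crux]
def PadicMemberCompatibility : Prop :=
  ∀ (K : Type) [Field K] [NumberField K] (n : ℕ) (hcpt : Literature.NumberTheory.Automorphic.isCompact_glFiniteIntegralLevel n K), 0 < n → ∀ (π : Literature.NumberTheory.Automorphic.CuspidalAutomorphicRepData n K hcpt), π.1.IsLAlgebraic → ∀ (ℓ : ℕ) [Fact ℓ.Prime] (ι : PadicAlgCl ℓ ≃+* ℂ) (ρ : Literature.NumberTheory.GaloisRepresentations.FramedGaloisRep K (PadicAlgCl ℓ) n), ρ.toGaloisRep.IsIrreducible → (∀ᶠ v : IsDedekindDomain.HeightOneSpectrum (NumberField.RingOfIntegers K) in cofinite, SatakeFrobCompatibleAt ι π.1 ρ v) → ∀ (v : IsDedekindDomain.HeightOneSpectrum (NumberField.RingOfIntegers K)) (hv : ((ℓ : ℕ) : NumberField.RingOfIntegers K) ∈ v.asIdeal), (Literature.NumberTheory.PAdicHodge.fontainePstAdicCompletion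 v ℓ hv).IsDeRhamFramed (ρ.toLocal v) ∧ ∀ (Rec : ReciprocityData K) (ℓ' : ℕ) [Fact ℓ'.Prime] (ι' : PadicAlgCl ℓ' ≃+* ℂ) (ρ' : Literature.NumberTheory.GaloisRepresentations.FramedGaloisRep K (PadicAlgCl ℓ') n), ((ℓ' : ℕ) : NumberField.RingOfIntegers K) ∉ v.asIdeal → ρ'.toGaloisRep.IsIrreducible → (∀ᶠ w : IsDedekindDomain.HeightOneSpectrum (NumberField.RingOfIntegers K) in cofinite, SatakeFrobCompatibleAt ι' π.1 ρ' w) → LocalGlobalCompatibleAt Rec ι' π.1 ρ' v → LocalGlobalCompatibleAt Rec ι π.1 ρ v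

/-- item stmt-Langlands-23601 · crux · rank 7 · SPLIT (gen 1) into RegularMonodromyPlaceIrreducible, NoRegularMonodromyIrreducible + glue CuspidalAvatarIrreducible_of_split · direct attempts still welcome (low priority) · by planner
why it might fail: Open for n ≥ 4 in general even over ℚ with regular weight (only density-one sets of ℓ, Patrikis–Taylor); for irregular π there is not even a candidate argument, and potential automorphy of the summands is the missing input.
sources: Ramakrishnan2008Irreducibility, PatrikisTaylor2014, CalegariGee2013, BockleHui2025
[crux] [NEW root-level piece, the irreducibility half of W⁺; verbatim the registered stub
`…SectorComplement.BirthSatakeAvatarExistence.stub_cuspidalAvatarIrreducible`; WEAKER than Langlands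
(necessity: a semisimple Satake-compatible ρ is conjugate to the irreducible avatar by Chebotarev +
Brauer–Nesbitt, cf. `SoloBlind.isIrreducible_of_eventually`); leaf IDEA-NEEDED, «no catalogued
barrier»; known: n ≤ 3 (Ribet, Blasius–Rogawski), polarizable regular n ≤ 5 / density-one ℓ
(Calegari–Gee, Patrikis–Taylor, Böckle–Hui 2025); Rec-free root-level parent of the irreducibility
sector routes (IrreducibilityBySelfDuality, ExteriorSquareAscent, FrobeniusMoment); critic: CLEARED
decomp-langlands-crit-1-g0 0 2026-08-30T01:15:58Z (pub/decomp-langlands/STATUS.md; CRITIC-LEDGER.md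
row 01:15:58Z)] every SEMISIMPLE framed ρ : Γ_K → GL_n(ℚ̄_ℓ) that is Satake–Frobenius compatible
a.e. with an L-algebraic CUSPIDAL (π, ι) is irreducible (Ramakrishnan's cuspidality ⇒ irreducibility
conjecture, Satake-level form). [deps: SemisimpleAvatar] [difficulty: open-problem] -/
@[route_item "route-Langlands-RootDecomp1", crux]
def CuspidalAvatarIrreducible : Prop :=
  ∀ (K : Type) [Field K] [NumberField K] (n : ℕ) (hcpt : Literature.NumberTheory.Automorphic.isCompact_glFiniteIntegralLevel n K), 0 < n → ∀ (π : Literature.NumberTheory.Automorphic.CuspidalAutomorphicRepData n K hcpt), π.1.IsLAlgebraic → ∀ (ℓ : ℕ) [Fact ℓ.Prime] (ι : PadicAlgCl ℓ ≃+* ℂ) (ρ : Literature.NumberTheory.GaloisRepresentations.FramedGaloisRep K (PadicAlgCl ℓ) n), ρ.toGaloisRep.IsSemisimple → (∀ᶠ v : IsDedekindDomain.HeightOneSpectrum (NumberField.RingOfIntegers K) in cofinite, SatakeFrobCompatibleAt ι π.1 ρ v) → ρ.toGaloisRep.IsIrreducible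

-- parent: CuspidalAvatarIrreducible · child (gen 1)
/--     item stmt-Langlands-31314 · crux · rank 701 · open
    parent: CuspidalAvatarIrreducible · by planner
    why it might fail: For non-polarizable π over CM K only WD(r_ι(π)|v) ≺ rec(π_v) is known (Varma 2024 Thm 2): the avatar is an ℓ-adic limit of polarizable reps and monodromy can drop in limits (MonodromyNotClosedUnderPadicLimits), so WD(ρ|v) may have N = 0 and decompose though π_v ≃ St_n ⊗ χ.
    sources: TaylorYoshida2007, Caraiani2012, Caraiani2014, VarmaFMS2024, AHTW2026, AllenNewton2020
[crux] (RM-cell, child of CuspidalAvatarIrreducible = Irr stmt-Langlands-23601; lens-2-g7 node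
MonodromyPlaceDichotomy = the crit-1 row-74 re-cut (F1) of the g6 node DiscretePlaceTrichotomy; tags
WEAKER · IDEA-NEEDED inside BARRIER
`Literature.Barriers.Langlands.MonodromyNotClosedUnderPadicLimits`; layer 2) Irr restricted to the
cuspidal L-algebraic π that HAVE A REGULAR-MONODROMY PLACE (inlined dial RM(π) = ∃ v, ∃ πv :
SmoothIrrep GL_n(K_v), π.1.HasLocalComponentAt v πv.ρ ∧ (πv.ρ.IsEssentiallyDiscreteSeries μ for
every Haar μ on GL_n(K_v)/Z) ∧ (∃ smooth χ : GL_n(K_v) →* ℂˣ, ∃ w ≠ 0 fixed by iwahoriGL n K_v under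
πv.ρ.twist χ) — i.e. π_v ≃ St_n ⊗ χ, i.e. N(rec(π_v)) REGULAR nilpotent (Borel–Casselman +
Bernstein–Zelevinsky; rec(St_n ⊗ χ) = χ ⊗ Sp(n))). ORBIT-INVARIANT: the Jordan type of N is
unchanged by ⊗ Hecke character and by cyclic base change (rec(BC π)_w = rec(π_v)|W_{L_w}), an RM π
is η-primitive for every η (an induced parameter never has regular N) so it stays cuspidal and RM up
every solvable tower, and AI never lands in the cell — the pure-Steinberg core CLEARED as a piece in
CRITIC-LEDGER row 74. LEVER (local, ONE place, MONODROMY half of local–global compatibility): W -/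
@[route_item "route-Langlands-RootDecomp1"]
def RegularMonodromyPlaceIrreducible : Prop :=
  ∀ (K : Type) [Field K] [NumberField K] (n : ℕ) (hcpt : Literature.NumberTheory.Automorphic.isCompact_glFiniteIntegralLevel n K), 0 < n → ∀ (π : Literature.NumberTheory.Automorphic.CuspidalAutomorphicRepData n K hcpt), π.1.IsLAlgebraic → (∃ (v : IsDedekindDomain.HeightOneSpectrum (NumberField.RingOfIntegers K)) (πv : Literature.NumberTheory.Automorphic.SmoothIrrep (Matrix.GeneralLinearGroup (Fin n) (v.adicCompletion K))), π.1.HasLocalComponentAt v πv.ρ ∧ (∀ [MeasurableSpace (Matrix.GeneralLinearGroup (Fin n) (v.adicCompletion K) ⧸ Subgroup.center (Matrix.GeneralLinearGroup (Fin n) (v.adicCompletion K)))] [BorelSpace (Matrix.GeneralLinearGroup (Fin n) (v.adicCompletion K) ⧸ Subgroup.center (Matrix.GeneralLinearGroup (Fin n) (v.adicCompletion K)))] (μ : MeasureTheory.Measure (Matrix.GeneralLinearGroup (Fin n) (v.adicCompletion K) ⧸ Subgroup.center (Matrix.GeneralLinearGroup (Fin n) (v.adicCompletion K)))) [μ.IsHaarMeasure],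 πv.ρ.IsEssentiallyDiscreteSeries μ) ∧ ∃ χ : Matrix.GeneralLinearGroup (Fin n) (v.adicCompletion K) →* ℂˣ, IsOpen (χ.ker : Set (Matrix.GeneralLinearGroup (Fin n) (v.adicCompletion K))) ∧ ∃ w : πv.V, w ≠ 0 ∧ ∀ g ∈ Literature.NumberTheory.Automorphic.iwahoriGL n (v.adicCompletion K), (πv.ρ.twist χ) g w = w) → ∀ (ℓ : ℕ) [Fact ℓ.Prime] (ι : PadicAlgCl ℓ ≃+* ℂ) (ρ : Literature.NumberTheory.GaloisRepresentations.FramedGaloisRep K (PadicAlgCl ℓ) n), ρ.toGaloisRep.IsSemisimple → (∀ᶠ v : IsDedekindDomain.HeightOneSpectrum (NumberField.RingOfIntegers K) in cofinite, SatakeFrobCompatibleAt ι π.1 ρ v) → ρ.toGaloisRep.IsIrreducible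

-- parent: CuspidalAvatarIrreducible · child (gen 1)
/--     item stmt-Langlands-31315 · crux · rank 702 · open
    parent: CuspidalAvatarIrreducible
    reduced to route-Langlands-CofinitePrimeSplit: SemisimpleAvatar, CofinitePrimeIrreducible, IrreduciblePrimeTransport · residual IrreduciblePrimeTransport
    refined by: route-Langlands-CofinitePrimeSplit [split, draft] · by planner
    why it might fail: Off the TR/CM × regular-algebraic locus (K = ℚ(∛2), or π non-regular) no engine excludes ρ = χ ⊕ σ with σ non-automorphic; even on it, for non-polarizable π of level one and n ≥ 5 neither potential automorphy of summands nor any local lever is available.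
    sources: CalegariGee2013, PatrikisTaylor2014, BockleHui2025, Hui2023, Shavali2026GL4, VarmaFMS2024
[crux] (NRM-cell, child of CuspidalAvatarIrreducible = Irr stmt-Langlands-23601; lens-2-g7 node
MonodromyPlaceDichotomy; tags WEAKER · DECLARED RESIDUAL of the split (no catalogued barrier names
it; no local lever); layer 2) Irr restricted to the cuspidal L-algebraic π with NO regular-monodromy
place (inlined ¬RM(π): no local component is essentially square-integrable and Iwahori-spherical
after a smooth twist ⟺ no π_v ≃ St_n ⊗ χ ⟺ N(rec(π_v)) regular nowhere), GIVEN Irr at every rank m <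
n over every number field (the rank induction hypothesis, inlined verbatim as «∀ m < n, Irr at rank
m», typed exactly as the accepted row-26 item LieTypeCarving.LieImprimitiveTransport; at n = 2 it
holds outright — node kernel `ih_below_two`). ORBIT-CLOSED: ¬RM is stable under ⊗χ and cyclic base
change (same N); automorphically induced instances π = AI(τ) (never RM) carry, mod Arthur–Clozel
(1.1)/(3.6) + Jacquet–Shalika/SMO + Chebotarev–Brauer–Nesbitt + Mackey and mod E = SemisimpleAvatar
23598 at (L, n/p), exactly Irr for τ at rank n/p < n over L — which enters AS THE HYPOTHESIS, never
as content (row-22/26 discipline). Own content: η-primitive π with no pure-Steinberg place anywhere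
on their sol -/
@[route_item "route-Langlands-RootDecomp1"]
def NoRegularMonodromyIrreducible : Prop :=
  ∀ (K : Type) [Field K] [NumberField K] (n : ℕ) (hcpt : Literature.NumberTheory.Automorphic.isCompact_glFiniteIntegralLevel n K), 0 < n → ∀ (π : Literature.NumberTheory.Automorphic.CuspidalAutomorphicRepData n K hcpt), π.1.IsLAlgebraic → ¬ (∃ (v : IsDedekindDomain.HeightOneSpectrum (NumberField.RingOfIntegers K)) (πv : Literature.NumberTheory.Automorphic.SmoothIrrep (Matrix.GeneralLinearGroup (Fin n) (v.adicCompletion K))), π.1.HasLocalComponentAt v πv.ρ ∧ (∀ [MeasurableSpace (Matrix.GeneralLinearGroup (Fin n) (v.adicCompletion K) ⧸ Subgroup.center (Matrix.GeneralLinearGroup (Fin n) (v.adicCompletion K)))] [BorelSpace (Matrix.GeneralLinearGroup (Fin n) (v.adicCompletion K) ⧸ Subgroup.center (Matrix.GeneralLinearGroup (Fin n) (v.adicCompletion K)))] (μ : MeasureTheory.Measure (Matrix.GeneralLinearGroup (Fin n) (v.adicCompletion K) ⧸ Subgroup.center (Matrix.GeneralLinearGroup (Fin n) (v.adicCompletion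 K)))) [μ.IsHaarMeasure], πv.ρ.IsEssentiallyDiscreteSeries μ) ∧ ∃ χ : Matrix.GeneralLinearGroup (Fin n) (v.adicCompletion K) →* ℂˣ, IsOpen (χ.ker : Set (Matrix.GeneralLinearGroup (Fin n) (v.adicCompletion K))) ∧ ∃ w : πv.V, w ≠ 0 ∧ ∀ g ∈ Literature.NumberTheory.Automorphic.iwahoriGL n (v.adicCompletion K), (πv.ρ.twist χ) g w = w) → (∀ m : ℕ, m < n → ∀ (K : Type) [Field K] [NumberField K] (hcpt : Literature.NumberTheory.Automorphic.isCompact_glFiniteIntegralLevel m K), 0 < m → ∀ (π : Literature.NumberTheory.Automorphic.CuspidalAutomorphicRepData m K hcpt), π.1.IsLAlgebraic → ∀ (ℓ : ℕ) [Fact ℓ.Prime] (ι : PadicAlgCl ℓ ≃+* ℂ) (ρ : Literature.NumberTheory.GaloisRepresentations.FramedGaloisRep K (PadicAlgCl ℓ) m), ρ.toGaloisRep.IsSemisimple → (∀ᶠ v : IsDedekindDomain.HeightOneSpectrum (NumberField.RingOfIntegers K) in cofinite, SatakeFrobCompatibleAt ι π.1 ρ v) → ρ.toGaloisRep.IsIrreducible)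 → ∀ (ℓ : ℕ) [Fact ℓ.Prime] (ι : PadicAlgCl ℓ ≃+* ℂ) (ρ : Literature.NumberTheory.GaloisRepresentations.FramedGaloisRep K (PadicAlgCl ℓ) n), ρ.toGaloisRep.IsSemisimple → (∀ᶠ v : IsDedekindDomain.HeightOneSpectrum (NumberField.RingOfIntegers K) in cofinite, SatakeFrobCompatibleAt ι π.1 ρ v) → ρ.toGaloisRep.IsIrreducible

-- parent: CuspidalAvatarIrreducible · glue (gen 1)
/--     item stmt-Langlands-31316 · support · rank 703 · closed · proved by Summit.Langlands.Langlands.Theorems.CuspidalAvatarIrreducible_of_split_proof (prover)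
    parent: CuspidalAvatarIrreducible · GLUE: children ⟹ parent · by planner
RegularMonodromyPlaceIrreducible → NoRegularMonodromyIrreducible → CuspidalAvatarIrreducible — pure
logic: strong induction on the rank n (the NRM child carries «Irr at every rank m < n» as an inlined
hypothesis) and ONE excluded middle on the inlined dial RM(π) = «some local component of π is
essentially square-integrable and Iwahori-spherical after a smooth twist» (π_v ≃ St_n ⊗ χ, N(rec
π_v) regular) (lens-2-g7 node MonodromyPlaceDichotomy.CuspidalAvatarIrreducible_of_split; certified
against the mock render kit_check.lean; Theorems-side proof staged:
nodes/lens-2-g7-MonodromyPlaceDichotomy.split_glue.lean →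
Theorems/RootDecomp1CuspidalAvatarIrreducibleOfSplit.lean) -/
@[route_item "route-Langlands-RootDecomp1"]
def CuspidalAvatarIrreducible_of_split : Prop :=
  RegularMonodromyPlaceIrreducible → NoRegularMonodromyIrreducible → CuspidalAvatarIrreducible

-- `CuspidalAvatarIrreducible_of_split` holds: proved by `Summit.Langlands.Langlands.Theorems.CuspidalAvatarIrreducible_of_split_proof` (its module imports this route file, so no `_holds` link can be stated here).

/-- item stmt-Langlands-23599 · aside · rank 4 · open · by planner
why it might fail: Weight–monodromy for automorphic Galois representations is known only in the polarizable regular case; for non-polarizable regular π over CM only Wℂ ≺ rec is known (Varma 2024), and every known construction there is an ℓ-adic limit, which destroys N.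
sources: TaylorYoshida2007, Caraiani2012, VarmaFMS2024, arXiv:1407.2135
[crux] [NEW root-level piece N = the monodromy half of L∤R; verbatim the registered stub
`…Cruxes.CompatibilityAwayFromLR.Birth.stub_monodromyUpgrade`; WEAKER than L∤R (implied via
Deligne's independence of (t, Φ) `IsWeilDeligneOfLadic.isEquivalent` + uniqueness of local
components; does not give the trace identity S) and than Langlands; OPEN; leaf
BARRIER(Literature.Barriers.Langlands.MonodromyNotClosedUnderPadicLimits,
`not_ladicLimitsPreserveMonodromy`: N is lost under ℓ-adic limits) + IDEA-NEEDED; known: polarizable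
regular case (Taylor–Yoshida, Caraiani), Varma 2024 only Wℂ ≺ S; non-costume parent of the
CM-regular target `EisensteinMonodromy.GenericMonodromy` (10863); critic: CLEARED crit-1-g0
2026-08-30T01:15:58Z] for EVERY pinned datum Rec, every L-algebraic cuspidal π, every irreducible
pinned-geometric Satake-compatible ρ, every v ∤ ℓ, local component π_v, Weil–Deligne module W of
ρ|_v with transport Wℂ along ι and Frobenius-semisimple S ∈ rec_Rec,v(π_v): tr Wℂ = tr S on W_K_v ⟹
Wℂ ≃ S up to F-semisimplification (`HasFrobSemisimpleClass`), i.e. ρ has the generic monodromy at v.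
[deps: SemisimpleMatchingOneDatum] [difficulty: open-problem] -/
@[route_item "route-Langlands-RootDecomp1"]
def MonodromyUpgrade : Prop :=
  ∀ (K : Type) [Field K] [NumberField K] (Rec : ReciprocityData K) (n : ℕ) (hcpt : Literature.NumberTheory.Automorphic.isCompact_glFiniteIntegralLevel n K), 0 < n → ∀ (π : Literature.NumberTheory.Automorphic.CuspidalAutomorphicRepData n K hcpt), π.1.IsLAlgebraic → ∀ (ℓ : ℕ) [Fact ℓ.Prime] (ι : PadicAlgCl ℓ ≃+* ℂ) (ρ : Literature.NumberTheory.GaloisRepresentations.FramedGaloisRep K (PadicAlgCl ℓ) n), ρ.toGaloisRep.IsIrreducible → ((∀ᶠ v : IsDedekindDomain.HeightOneSpectrum (NumberField.RingOfIntegers K) in cofinite, ρ.IsUnramifiedAt v) ∧ ∀ (v : IsDedekindDomain.HeightOneSpectrum (NumberField.RingOfIntegers K)) (hv : ((ℓ : ℕ) : NumberField.RingOfIntegers K) ∈ v.asIdeal), (Literature.NumberTheory.PAdicHodge.fontainePstAdicCompletion v ℓ hv).IsDeRhamFramed (ρ.toLocal v)) → (∀ᶠ v : IsDedekindDomain.HeightOneSpectrum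 (NumberField.RingOfIntegers K) in cofinite, SatakeFrobCompatibleAt ι π.1 ρ v) → ∀ v : IsDedekindDomain.HeightOneSpectrum (NumberField.RingOfIntegers K), ((ℓ : ℕ) : NumberField.RingOfIntegers K) ∉ v.asIdeal → ∀ (πv : Literature.NumberTheory.Automorphic.SmoothIrrep (Matrix.GeneralLinearGroup (Fin n) (v.adicCompletion K))), π.1.HasLocalComponentAt v πv.ρ → ∀ (W : Literature.NumberTheory.GaloisRepresentations.WeilDeligneRep (v.adicCompletion K) (PadicAlgCl ℓ) (Fin n → (PadicAlgCl ℓ))) (Wℂ : Literature.NumberTheory.GaloisRepresentations.WeilDeligneRep (v.adicCompletion K) ℂ (Fin n → ℂ)), Literature.NumberTheory.GaloisRepresentations.IsWeilDeligneOfLadic (ρ.toLocal v).toWeilGroupHom W → W.IsTransportAlong (ι : PadicAlgCl ℓ →+* ℂ) Wℂ → ∀ (S : Literature.NumberTheory.GaloisRepresentations.WeilDeligneRep (v.adicCompletion K) ℂ (Fin n → ℂ)) (hS : S.IsFrobSemisimple), Quotient.mk (Literature.NumberTheory.Automorphic.frobSemisimpleWDSetoid (v.adicCompletion K) n) ⟨S,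 hS⟩ = (Rec.llc v).recGL n (Literature.NumberTheory.Automorphic.IrrClass.mk πv) → (∀ w : Literature.NumberTheory.GaloisRepresentations.WeilGroup (v.adicCompletion K), LinearMap.trace ℂ (Fin n → ℂ) (Wℂ.ρ w) = LinearMap.trace ℂ (Fin n → ℂ) (S.ρ w)) → Wℂ.HasFrobSemisimpleClass ((Rec.llc v).recGL n (Literature.NumberTheory.Automorphic.IrrClass.mk πv))

/-- item stmt-Langlands-17415 · aside · rank 9 · open · by planner
sources: BuzzardGeeLMS2014, HarrisLanTaylorThorneRMS2016, Scholze2015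
[crux] W⁺ — for every number field K, n ≥ 1, every L-algebraic cuspidal π of GL_n(𝔸_K) and every (ℓ,
ι) there is an IRREDUCIBLE ρ : Γ_K → GL_n(ℚ̄_ℓ) Satake–Frobenius compatible with (π, ι) at almost
all places (Buzzard–Gee Conj. 3.2.2 weak form + Ramakrishnan's cuspidal ⇒ irreducible; Clozel's
Conj. 1.1.1 in arXiv:2607.11763). No de Rham clause, no Rec: ε-free and Rec-free. [difficulty:
open-problem] -/
@[route_item "route-Langlands-RootDecomp1"]
def SatakeAvatarExistence : Prop :=
  ∀ (K : Type) [Field K] [NumberField K] (n : ℕ) (hcpt : Literature.NumberTheory.Automorphic.isCompact_glFiniteIntegralLevel n K), 0 < n → ∀ (π : Literature.NumberTheory.Automorphic.CuspidalAutomorphicRepData n K hcpt), π.1.IsLAlgebraic → ∀ (ℓ : ℕ) [Fact ℓ.Prime] (ι : PadicAlgCl ℓ ≃+* ℂ), ∃ ρ : Literature.NumberTheory.GaloisRepresentations.FramedGaloisRep K (PadicAlgCl ℓ) n, ρ.toGaloisRep.IsIrreducible ∧ ∀ᶠ v : IsDedekindDomain.HeightOneSpectrum (NumberField.RingOfIntegers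 K) in cofinite, SatakeFrobCompatibleAt ι π.1 ρ v

/-- item stmt-Langlands-17930 · support · rank 9 · open · by planner
sources: HarrisTaylorAMS2001, HenniartInventiones2000, Deligne1973Constantes
[support] THE SUMMIT'S NON-VACUITY CONJUNCT, verbatim (statement revision p141787, 2026-08-17:
`Langlands := ∀ F, Nonempty (ReciprocityData F) ∧ ∀ 𝓡 n, 0 < n → ∀ hcpt, GLC n F 𝓡 hcpt`, with
`ReciprocityData` pinned to THE local Artin maps by `llc_isCanonical` / `llc_eps_isCanonical`),
filed by route-repair 5a1bd9af as the explicit INPUT of this route's `∃ RD`-shaped slices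
(LiftB2Unram, LiftB2UnramSmallF, LiftB2UnramLargeF, LiftB2UnramSplitP): for every number field F and
every finite place v, a local Langlands datum for GL_n(F_v) (Harris–Taylor 2001 Thm A; Henniart 2000
Thm 1.2) normalised against THE local Artin map `canonicalArtin (F_v)`, whose ε-system (Deligne 1973
Thm 4.1) is normalised against the canonical Artin map of every finite E/F_v. IN PRINT,
textbook-grade input (Harris–Taylor's Thm A is stated relative to Art_K of local class field
theory); in the TREE not yet derivable — `LocalLanglandsDatum.nonempty` (cite-only) yields a datum
with SOME lawful Artin normalisation, and canonicity needs `IsLocalArtinMap.unique` + the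
finite-level reciprocity law for that datum's Artin maps, or canonical variants of
`localLanglands_gl` / `nonempty_localEpsilonSystem` (needs-fact for -/
@[route_item "route-Langlands-RootDecomp1", crux]
def CanonicalReciprocityData : Prop :=
  ∀ (F : Type) [Field F] [NumberField F], Nonempty (Summit.Langlands.ReciprocityData F)

/-- item stmt-Langlands-18084 · aside · rank 9 · open · by planner
sources: TaylorGaloisRepresentations2004, HarrisTaylorAMS2001, HenniartInventiones2000, VarmaFMS2024
[crux] L∤R — Taylor 2004 Conj. 7 at the places v ∤ ℓ, in the `∀ Rec` form (rev 4, lockstep re-type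
after the summit re-type p141787 `∀ F, Nonempty (ReciprocityData F) ∧ ∀ 𝓡 …`): for every number
field K and EVERY reciprocity datum Rec (Henniart-normalised local Langlands data with THE canonical
Artin pins — the summit's `∀ 𝓡`), every n ≥ 1 and hcpt, every L-algebraic cuspidal π of GL_n(𝔸_K),
every (ℓ, ι) and every IRREDUCIBLE ρ : Γ_K → GL_n(ℚ̄_ℓ) that is pinned-geometric (unramified a.e.,
de Rham above ℓ for Fontaine's pinned datum) and Satake–Frobenius compatible with (π, ι) a.e.:
`LocalGlobalCompatibleAt Rec ι π ρ v` at every finite v ∤ ℓ (Grothendieck–Deligne Weil–Deligne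
representation, Frobenius-semisimplified, ↔ rec_v(π_v)). = item L∤ (stmt-Langlands-17417, ∃-Rec
form; verbatim the registered stub `stub_pairCompatibilityAway` of line `Sketch` of crux 14328) with
Rec moved from `∃ Rec,` to a universal binder after K and nothing else changed; the ∃-form is
implied back by L∤R ∧ CanonicalReciprocityData (`compatibilityAwayFromL_existsForm`).
Kernel-certified consequence of the re-typed summit (`compatibilityAwayFromLR_of_langlands`, planner
bc/SubsOfLanglandsR.lean: direction (A -/
@[route_item "route-Langlands-RootDecomp1"]
def CompatibilityAwayFromLR : Prop :=
  ∀ (K : Type) [Field K] [NumberField K] (Rec : ReciprocityData K) (n : ℕ) (hcpt : Literature.NumberTheory.Automorphic.isCompact_glFiniteIntegralLevel n K), 0 < n → ∀ (π : Literature.NumberTheory.Automorphic.CuspidalAutomorphicRepData n K hcpt), π.1.IsLAlgebraic → ∀ (ℓ : ℕ) [Fact ℓ.Prime] (ι : PadicAlgCl ℓ ≃+* ℂ) (ρ : Literature.NumberTheory.GaloisRepresentations.FramedGaloisRep K (PadicAlgCl ℓ) n), ρ.toGaloisRep.IsIrreducible → ((∀ᶠ v : IsDedekindDomain.HeightOneSpectrum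 (NumberField.RingOfIntegers K) in cofinite, ρ.IsUnramifiedAt v) ∧ ∀ (v : IsDedekindDomain.HeightOneSpectrum (NumberField.RingOfIntegers K)) (hv : ((ℓ : ℕ) : NumberField.RingOfIntegers K) ∈ v.asIdeal), (Literature.NumberTheory.PAdicHodge.fontainePstAdicCompletion v ℓ hv).IsDeRhamFramed (ρ.toLocal v)) → (∀ᶠ v : IsDedekindDomain.HeightOneSpectrum (NumberField.RingOfIntegers K) in cofinite, SatakeFrobCompatibleAt ι π.1 ρ v) → ∀ v : IsDedekindDomain.HeightOneSpectrum (NumberField.RingOfIntegers K), ((ℓ : ℕ) : NumberField.RingOfIntegers K) ∉ v.asIdeal → LocalGlobalCompatibleAt Rec ι π.1 ρ v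

/-- item stmt-Langlands-23602 · support · rank 9 · closed · proved by Summit.Langlands.Langlands.Theorems.SatakePlacesAllData_proof (prover) · by planner
sources: BuzzardGeeLMS2014, JacquetShalika1981, TateCorvallis1979
[support] [piece G of the L∤R split; verbatim the registered stub
`…CompatibilityAwayFromLR.Birth.stub_goodPlaces`; WEAKER (a theorem); leaf ATTACKABLE NOW — n ≥ 2:
landed
`Summit.Langlands.Langlands.Theorems.ReciprocityUpToIrreducibility.stub_rankN_localGlobalCompatibleAt_of_satakeFrobCompatibleAt`
/ `localGlobalCompatibleAt_away_of_isUnramifiedAt` (only the v ∤ ℓ branch is needed), n = 1: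
`rankOne_localGlobalCompatibleAt_of_satakeFrobCompatibleAt`; critic: CLEARED
decomp-langlands-crit-1-g0 0 2026-08-30T01:15:58Z (pub/decomp-langlands/STATUS.md; CRITIC-LEDGER.md
row 01:15:58Z)] at a Satake-compatible place v ∤ ℓ the summit's LocalGlobalCompatibleAt Rec ι π ρ v
holds for EVERY pinned datum Rec (unramified local Langlands = the Satake parameter; Buzzard–Gee
3.2.1 is Taylor's clause there). [difficulty: provable-now] -/
@[route_item "route-Langlands-RootDecomp1", crux]
def SatakePlacesAllData : Prop :=
  ∀ (K : Type) [Field K] [NumberField K] (Rec : ReciprocityData K) (n : ℕ) (hcpt : Literature.NumberTheory.Automorphic.isCompact_glFiniteIntegralLevel n K), 0 < n → ∀ (π : Literature.NumberTheory.Automorphic.CuspidalAutomorphicRepData n K hcpt) (ℓ : ℕ) [Fact ℓ.Prime] (ι : PadicAlgCl ℓ ≃+* ℂ) (ρ : Literature.NumberTheory.GaloisRepresentations.FramedGaloisRep K (PadicAlgCl ℓ) n) (v : IsDedekindDomain.HeightOneSpectrum (NumberField.RingOfIntegers K)), ((ℓ : ℕ) : NumberField.RingOfIntegers K) ∉ v.asIdeal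 → SatakeFrobCompatibleAt ι π.1 ρ v → LocalGlobalCompatibleAt Rec ι π.1 ρ v

-- `SatakePlacesAllData` holds: proved by `Summit.Langlands.Langlands.Theorems.SatakePlacesAllData_proof` (its module imports this route file, so no `_holds` link can be stated here).

/-- item stmt-Langlands-23603 · support · rank 9 · open · by planner
sources: HenniartBSMF2002, HarrisTaylorAMS2001, Shalika1974
[support] [piece R of the L∤R split; verbatim the registered stub
`…CompatibilityAwayFromLR.Birth.stub_recRigidity`; WEAKER (L∤R forces it: landed
`Theorems/CompatibilityAwayFromLR/Negative/RigidOfCompatibilityAwayFromLR.lean`,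
`recGL_eq_of_compatibilityAwayFromLR`); leaf ATTACKABLE closed-mod-print: conclusion of the landed
glue `ReciprocityUpToIrreducibilityR.stub_recRigidityLAlg_of_genericRigidity ∘
stub_genericRigidity_of_facts` from five local facts (localLanglands_gl, generic preimages, Henniart
2002 Thm 1.7(a) / 1.6(b), invariant measures); critic: CLEARED decomp-langlands-crit-1-g0 0
2026-08-30T01:15:58Z (pub/decomp-langlands/STATUS.md; CRITIC-LEDGER.md row 01:15:58Z)] any two
pinned reciprocity data give the same class rec_v(π_v) to every local component of every L-algebraic
cuspidal π (Henniart's uniqueness of rec_v on generic classes; local components of cusp forms are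
generic by Shalika). [difficulty: provable-now] -/
@[route_item "route-Langlands-RootDecomp1", crux]
def RecRigidity : Prop :=
  ∀ (K : Type) [Field K] [NumberField K] (Rec Rec' : ReciprocityData K) (n : ℕ) (hcpt : Literature.NumberTheory.Automorphic.isCompact_glFiniteIntegralLevel n K), 0 < n → ∀ (π : Literature.NumberTheory.Automorphic.CuspidalAutomorphicRepData n K hcpt), π.1.IsLAlgebraic → ∀ (v : IsDedekindDomain.HeightOneSpectrum (NumberField.RingOfIntegers K)) (πv : Literature.NumberTheory.Automorphic.SmoothIrrep (Matrix.GeneralLinearGroup (Fin n) (v.adicCompletion K))), π.1.HasLocalComponentAt v πv.ρ → (Rec.llc v).recGL n (Literature.NumberTheory.Automorphic.IrrClass.mk πv) = (Rec'.llc v).recGL n (Literature.NumberTheory.Automorphic.IrrClass.mk πv)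

/-- item stmt-Langlands-2374 · support · rank 9 · closed · proved by Summit.Langlands.Langlands.Theorems.GenericWDUnique_proof (prover) · by planner
why it might fail: it does not (theorem: Brauer–Nesbitt + AHTW 2026 Prop 6.0.5, the latter proved in tree); the Lean work is Brauer–Nesbitt for W_F-representations with finite image on inertia
sources: arXiv:2607.11763, Allen2016, Tate1979
[support] over an algebraically closed field of characteristic 0, two Frobenius-semisimple GENERIC
Weil–Deligne representations of W_F on the same space with equal traces of ρ(w) for all w are
isomorphic (ρ ≅ ρ' by Brauer–Nesbitt + "Φ-semisimple ⇒ semisimple"; generic ⇔ N in the open orbit of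
the centraliser on {N}; the open orbit is unique). This is the lemma turning X + Varma's semisimple
compatibility into the summit's v ∤ ℓ clause; pure algebra, provable now. [difficulty: provable-now] -/
@[route_item "route-Langlands-RootDecomp1", crux]
def GenericWDUnique : Prop :=
  ∀ (F : Type) [Field F] [ValuativeRel F] [TopologicalSpace F] [IsNonarchimedeanLocalField F] (E : Type) [Field E] [IsAlgClosed E] [CharZero E] (n : ℕ) (W W' : Literature.NumberTheory.GaloisRepresentations.WeilDeligneRep F E (Fin n → E)), W.IsFrobSemisimple → W'.IsFrobSemisimple → (∀ w : Literature.NumberTheory.GaloisRepresentations.WeilGroup F, LinearMap.trace E (Fin n → E) (W.ρ w) = LinearMap.trace E (Fin n → E) (W'.ρ w)) → (∀ f : (Fin n → E) →ₗ[E] (Fin n → E), (∀ w : Literature.NumberTheory.GaloisRepresentations.WeilGroup F, f ∘ₗ W.ρ w = ((Literature.NumberTheory.GaloisRepresentations.IsNonarchimedeanLocalField.residueFieldCard F : E) ^ (Literature.NumberTheory.GaloisRepresentations.WeilGroup.deg w)) • (W.ρ w ∘ₗ f)) → f ∘ₗ W.N = W.N ∘ₗ f → f = 0) → (∀ f : (Fin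 n → E) →ₗ[E] (Fin n → E), (∀ w : Literature.NumberTheory.GaloisRepresentations.WeilGroup F, f ∘ₗ W'.ρ w = ((Literature.NumberTheory.GaloisRepresentations.IsNonarchimedeanLocalField.residueFieldCard F : E) ^ (Literature.NumberTheory.GaloisRepresentations.WeilGroup.deg w)) • (W'.ρ w ∘ₗ f)) → f ∘ₗ W'.N = W'.N ∘ₗ f → f = 0) → W.IsEquivalent W'

/-- `GenericWDUnique` holds: proved by `Summit.Langlands.Langlands.Theorems.GenericWDUnique_proof`. -/
theorem GenericWDUnique_holds : GenericWDUnique := _root_.Summit.Langlands.Langlands.Theorems.GenericWDUnique_proof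

/-- item stmt-Langlands-25108 · support · rank 9 · open · by planner
why it might fail: only via the datum axioms: a pinned LocalLanglandsDatum differing from Harris–Taylor rec on a generic class (Henniart-sharpness of axioms (h1)–(h5)) would break the transfer — same exposure as RecRigidity 23603
sources: Shalika1974, Allen2016, arXiv:2607.11763, Henniart1993, HarrisTaylor2001
RECGEN — for every reciprocity datum Rec on K, every n ≥ 1, every L-algebraic cuspidal π of GL_n/K
and every finite place v with local component π_v: every Frobenius-semisimple member S of the class
rec_v(π_v) = (Rec.llc v).recGL n [π_v] is generic. Closed modulo print: π_v is generic (Shalika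
1974, global genericity of cusp forms on GL_n) and rec_v of a generic irreducible representation has
generic (F-semisimple) Weil–Deligne parameter (Allen 2016 Lemma 1.1.3 / AHTW 2026 §6, via
Bernstein–Zelevinsky), transported to any pinned datum by Henniart's uniqueness. TAGS (lens-6
MonodromyCarving v2; crit-1 CLEARED rows 9/12): NEW support · closed-mod-print (Shalika 1974; Allen
2016 L.1.1.3 / AHTW 2026 §6; Henniart uniqueness) · WEAKER · the print half of the algebraic seam
GEN ∧ RECGEN ∧ WDU ⟹ N. -/
@[route_item "route-Langlands-RootDecomp1", crux]
def RecPreservesGenericity : Prop :=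
  ∀ (K : Type) [Field K] [NumberField K] (Rec : ReciprocityData K) (n : ℕ) (hcpt : Literature.NumberTheory.Automorphic.isCompact_glFiniteIntegralLevel n K), 0 < n → ∀ (π : Literature.NumberTheory.Automorphic.CuspidalAutomorphicRepData n K hcpt), π.1.IsLAlgebraic → ∀ (v : IsDedekindDomain.HeightOneSpectrum (NumberField.RingOfIntegers K)) (πv : Literature.NumberTheory.Automorphic.SmoothIrrep (Matrix.GeneralLinearGroup (Fin n) (v.adicCompletion K))), π.1.HasLocalComponentAt v πv.ρ → ∀ (S : Literature.NumberTheory.GaloisRepresentations.WeilDeligneRep (v.adicCompletion K) ℂ (Fin n → ℂ)) (hS : S.IsFrobSemisimple), Quotient.mk (Literature.NumberTheory.Automorphic.frobSemisimpleWDSetoid (v.adicCompletion K) n) ⟨S, hS⟩ = (Rec.llc v).recGL n (Literature.NumberTheory.Automorphic.IrrClass.mk πv) → ∀ f : (Fin n → ℂ) →ₗ[ℂ] (Fin n → ℂ), (∀ w : Literature.NumberTheory.GaloisRepresentations.WeilGroup (v.adicCompletion K), f ∘ₗ S.ρ w = ((Literature.NumberTheory.GaloisRepresentations.IsNonarchimedeanLocalField.residueFieldCard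 (v.adicCompletion K) : ℂ) ^ (Literature.NumberTheory.GaloisRepresentations.WeilGroup.deg w)) • (S.ρ w ∘ₗ f)) → f ∘ₗ S.N = S.N ∘ₗ f → f = 0

-- earlier Assembly (stmt-Langlands-23604, replaced 2026-08-30T02:20:55Z -> stmt-Langlands-25106): retired by None — WeakGeometricAutomorphy → SemisimpleAvatar → CuspidalAvatarIrreducible → PadicMemberCompatibility → SatakePlacesAllData → RecRigidity → SemisimpleMatchingOneDatum → MonodromyUpgrade → CanonicalReciprocityData → _root_.Langlands
/-- item stmt-Langlands-25106 · assembly · rank 1 · open · by planner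
sources: BuzzardGeeLMS2014, TaylorGaloisRepresentations2004, DeligneAntwerpII1973
[assembly] B_w → SemisimpleAvatar → CuspidalAvatarIrreducible → P → G → R → S → GEN → RECGEN → WDU →
CRD → Langlands (the curried form of `closes`, proved and applied inside it; W⁺, L∤R and N derived
internally). -/
@[route_item "route-Langlands-RootDecomp1"]
def Assembly : Prop :=
  WeakGeometricAutomorphy → SemisimpleAvatar → CuspidalAvatarIrreducible → PadicMemberCompatibility → SatakePlacesAllData → RecRigidity → SemisimpleMatchingOneDatum → GenericFibre → RecPreservesGenericity → GenericWDUnique → CanonicalReciprocityData → _root_.Langlands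

/-! D-0027 §2.1 — DECIDING THEOREM (planner-authored via `route open/edit --closes-file`; by planner-decomp-langlands-writer-1-g0-0 2026-08-30T02:20:55Z):
its hypotheses are this route's items and its conclusion the sub-problem Statement (glue_lint), and it elaborates with this file. -/

@[closes "route-Langlands-RootDecomp1"] theorem closes (hB : WeakGeometricAutomorphy) (hSS : SemisimpleAvatar)
    (hIrr : CuspidalAvatarIrreducible) (hP : PadicMemberCompatibility) (hG : SatakePlacesAllData)
    (hRig : RecRigidity) (hS : SemisimpleMatchingOneDatum) (hGEN : GenericFibre)
    (hRG : RecPreservesGenericity) (hWDU : GenericWDUnique)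
    (hR : CanonicalReciprocityData) : _root_.Langlands := by
  -- `Assembly` (item) is literally the curried form of this theorem: prove it, then apply it.
  suffices hAsm : Assembly from hAsm hB hSS hIrr hP hG hRig hS hGEN hRG hWDU hR
  clear hB hSS hIrr hP hG hRig hS hGEN hRG hWDU hR
  intro hB hSS hIrr hP hG hRig hS hGEN hRG hWDU hR
  -- internal AND-node W⁺ ⟸ SemisimpleAvatar ∧ CuspidalAvatarIrreducible (registered skeleton
  -- Cruxes/SectorComplement/Lines/birth_SatakeAvatarExistence.lean, `SatakeAvatarExistence_of`; CLEARED crit-1 01:15:58Z)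
  have hW : SatakeAvatarExistence := by
    intro K _ _ n hcpt hn π hL ℓ _ ι
    obtain ⟨ρ, hss, hρ⟩ := hSS K n hcpt hn π hL ℓ ι
    exact ⟨ρ, hIrr K n hcpt hn π hL ℓ ι ρ hss hρ, hρ⟩
  -- U = stmt-Langlands-17844, PROVED in the tree (Chebotarev + Brauer–Nesbitt; Deligne–Serre Lemme 3.2)
  have hU := @_root_.Summit.Langlands.Langlands.Theorems.EisensteinDegreeShiftSectorComplement.stub_avatarConjugacy
  -- internal AND-node N ⟸ GEN ∧ RECGEN ∧ WDU (lens-6 MonodromyCarving, kernel-checked in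
  -- nodes/lens-6-g0-MonodromyCarving.lean `monodromyUpgrade_of_generic`, re-proved here over this route's decls):
  -- F-semisimplify the transported WD rep (exists_isFrobSemisimplificationOf), traces are unchanged (nilpotent
  -- part is traceless), GEN makes it generic, RECGEN makes the rec-class member generic, WDU identifies them.
  have hN : MonodromyUpgrade := by
    intro K _ _ Rec n hcpt hn π hL ℓ _ ι ρ hirr hgeo hsat v hv πv hπv W Wℂ hW hι S hS hcl htr
    obtain ⟨r₁, hr₁⟩ := Wℂ.exists_isFrobSemisimplificationOf
    have htr₁ : ∀ w : Literature.NumberTheory.GaloisRepresentations.WeilGroup (v.adicCompletion K),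
        LinearMap.trace ℂ (Fin n → ℂ) (r₁.ρ w) = LinearMap.trace ℂ (Fin n → ℂ) (S.ρ w) := by
      intro w
      obtain ⟨m, hm, -, hw⟩ := (hr₁.2.2 w).2
      rw [← htr w, hw, map_add, (LinearMap.isNilpotent_trace_of_isNilpotent hm).eq_zero, add_zero]
    have hg₁ := hGEN K n hcpt hn π hL ℓ ι ρ hirr hgeo hsat v hv W Wℂ r₁ hW hι hr₁
    have hgS := hRG K Rec n hcpt hn π hL v πv hπv S hS hcl
    have he : r₁.IsEquivalent S :=
      hWDU (v.adicCompletion K) ℂ n r₁ S hr₁.isFrobSemisimple hS htr₁ hg₁ hgS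
    refine ⟨r₁, hr₁, ?_⟩
    rw [← hcl]
    exact Quotient.sound he
  -- internal AND-node L∤R ⟸ G ∧ R ∧ S ∧ N (registered skeleton Cruxes/CompatibilityAwayFromLR/Lines/birth.lean,
  -- `CompatibilityAwayFromLR_of`, re-proved here over this route's decls)
  have hA : CompatibilityAwayFromLR := by
    intro K _ _ Rec n hcpt hn π hL ℓ _ ι ρ hirr hgeo hρ v hv
    by_cases hsat : SatakeFrobCompatibleAt ι π.1 ρ v
    · exact hG K Rec n hcpt hn π ℓ ι ρ v hv hsat
    · obtain ⟨Rec₀, h₀⟩ := hS K ⟨Rec⟩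
      obtain ⟨πv, W, Wℂ, S, hFS, hloc, hW', htr, hcls, htrace⟩ :=
        h₀ n hcpt hn π hL ℓ ι ρ hirr hgeo hρ v hv hsat
      have hfs : Wℂ.HasFrobSemisimpleClass ((Rec₀.llc v).recGL n
          (Literature.NumberTheory.Automorphic.IrrClass.mk πv)) :=
        hN K Rec₀ n hcpt hn π hL ℓ ι ρ hirr hgeo hρ v hv πv hloc W Wℂ hW' htr S hFS hcls htrace
      obtain ⟨πv', r, rℂ, hloc', haway, habove, htrans, hclass⟩ :
          LocalGlobalCompatibleAt Rec₀ ι π.1 ρ v :=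
        ⟨πv, W, Wℂ, hloc, fun _ => hW', fun hv' => absurd hv' hv, htr, hfs⟩
      refine ⟨πv', r, rℂ, hloc', haway, habove, htrans, ?_⟩
      rw [← hRig K Rec₀ Rec n hcpt hn π hL v πv' hloc']
      exact hclass
  intro F _ _
  refine ⟨hR F, fun Rec n hn hcpt => ?_⟩
  have hRec := hA F Rec
  -- every finite place misses the prime 2 or the prime 3
  have hprime : ∀ v : IsDedekindDomain.HeightOneSpectrum (NumberField.RingOfIntegers F),
      ∃ (ℓ' : ℕ) (_ : Fact ℓ'.Prime), ((ℓ' : ℕ) : NumberField.RingOfIntegers F) ∉ v.asIdeal := by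
    intro v
    by_cases h2 : ((2 : ℕ) : NumberField.RingOfIntegers F) ∈ v.asIdeal
    · refine ⟨3, ⟨Nat.prime_three⟩, fun h3 => v.isPrime.ne_top ((Ideal.eq_top_iff_one _).2 ?_)⟩
      have h := v.asIdeal.sub_mem h3 h2
      have h1 : ((3 : ℕ) : NumberField.RingOfIntegers F) - ((2 : ℕ) : NumberField.RingOfIntegers F) = 1 := by
        push_cast; norm_num
      rwa [h1] at h
    · exact ⟨2, ⟨Nat.prime_two⟩, h2⟩
  -- geometric + compatible at EVERY finite place for irreducible Satake–Frobenius compatible pairs;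
  -- above ℓ the place is read through a prime below it (the prime switch, N0 = PrimeSwitchSplit)
  have hLGC : ∀ (π : Literature.NumberTheory.Automorphic.CuspidalAutomorphicRepData n F hcpt), π.1.IsLAlgebraic →
      ∀ (ℓ : ℕ) [Fact ℓ.Prime] (ι : PadicAlgCl ℓ ≃+* ℂ)
        (ρ : Literature.NumberTheory.GaloisRepresentations.FramedGaloisRep F (PadicAlgCl ℓ) n),
        ρ.toGaloisRep.IsIrreducible →
        (∀ᶠ v : IsDedekindDomain.HeightOneSpectrum (NumberField.RingOfIntegers F) in Filter.cofinite,
          SatakeFrobCompatibleAt ι π.1 ρ v) →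
        IsGeometricFramed Rec ρ ∧
          ∀ v : IsDedekindDomain.HeightOneSpectrum (NumberField.RingOfIntegers F),
            LocalGlobalCompatibleAt Rec ι π.1 ρ v := by
    intro π hL ℓ _ ι ρ hirr hρ
    have hgeo : (∀ᶠ v : IsDedekindDomain.HeightOneSpectrum (NumberField.RingOfIntegers F) in Filter.cofinite,
        ρ.IsUnramifiedAt v) ∧
        ∀ (v : IsDedekindDomain.HeightOneSpectrum (NumberField.RingOfIntegers F))
          (hv : ((ℓ : ℕ) : NumberField.RingOfIntegers F) ∈ v.asIdeal),
          (Literature.NumberTheory.PAdicHodge.fontainePstAdicCompletion v ℓ hv).IsDeRhamFramed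
            (ρ.toLocal v) :=
      ⟨hρ.mono fun v ⟨_, _, hur, _⟩ => hur, fun v hv => (hP F n hcpt hn π hL ℓ ι ρ hirr hρ v hv).1⟩
    refine ⟨hgeo, fun v => ?_⟩
    by_cases hv : ((ℓ : ℕ) : NumberField.RingOfIntegers F) ∈ v.asIdeal
    · obtain ⟨ℓ', _, hℓ'⟩ := hprime v
      obtain ⟨ι'⟩ := PadicAlgCl.nonempty_ringEquiv_complex ℓ'
      obtain ⟨ρ', hirr', hρ'⟩ := hW F n hcpt hn π hL ℓ' ι'
      have hgeo' : (∀ᶠ w : IsDedekindDomain.HeightOneSpectrum (NumberField.RingOfIntegers F) in Filter.cofinite,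
          ρ'.IsUnramifiedAt w) ∧
          ∀ (w : IsDedekindDomain.HeightOneSpectrum (NumberField.RingOfIntegers F))
            (hw : ((ℓ' : ℕ) : NumberField.RingOfIntegers F) ∈ w.asIdeal),
            (Literature.NumberTheory.PAdicHodge.fontainePstAdicCompletion w ℓ' hw).IsDeRhamFramed
              (ρ'.toLocal w) :=
        ⟨hρ'.mono fun w ⟨_, _, hur, _⟩ => hur,
          fun w hw => (hP F n hcpt hn π hL ℓ' ι' ρ' hirr' hρ' w hw).1⟩
      exact (hP F n hcpt hn π hL ℓ ι ρ hirr hρ v hv).2 Rec ℓ' ι' ρ' hℓ' hirr' hρ'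
        (hRec n hcpt hn π hL ℓ' ι' ρ' hirr' hgeo' hρ' v hℓ')
    · exact hRec n hcpt hn π hL ℓ ι ρ hirr hgeo hρ v hv
  refine ⟨?_, ?_⟩
  · -- (A) automorphic → Galois, uniqueness up to conjugacy from the proved support item U
    intro π hL ℓ _ ι
    obtain ⟨ρ, hirr, hρ⟩ := hW F n hcpt hn π hL ℓ ι
    obtain ⟨hgeo, hloc⟩ := hLGC π hL ℓ ι ρ hirr hρ
    exact ⟨ρ, hirr, hgeo, ⟨hρ, hloc⟩, fun ρ' h' => hU F n hcpt π ℓ ι ρ ρ' hirr hρ h'.1⟩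
  · -- (B) Galois → automorphic
    intro ℓ _ ι ρ hirr hgeo
    obtain ⟨π, hL, hρ⟩ := hB F n hcpt hn ℓ ι ρ hirr hgeo
    exact ⟨π, hL, hρ, (hLGC π hL ℓ ι ρ hirr hρ).2⟩

end Summit.Langlands.Langlands.Theses.RootDecomp1
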